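import Literature.MathematicalPhysics.QuantumFieldTheory.Balaban1983to89.T4BookingNecessity
import Literature.MathematicalPhysics.QuantumFieldTheory.Balaban1983to89.T4NestedShells
import Literature.MathematicalPhysics.QuantumFieldTheory.Balaban1983to89.T4ShellMeasure
import Literature.MathematicalPhysics.QuantumFieldTheory.Balaban1983to89.T4LipschitzCutoff
import Literature.MathematicalPhysics.QuantumFieldTheory.Balaban1983to89.T4ScalePairing

/-!
# `Balaban1983to89.T4ShellSuppressionRoute` — the WEIGHT ROUTE to the indicator-shell slot of the two-run matching:
what the printed large-field SUPPRESSION can and cannot book in `K` (cell `pub-balaban`, T⁴ fan-out row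
T4-U5.E-NE7-PROVE-P2* of `t4/CLAIMS.log`; node U5 of `t4/T4-DAG.md` v15/v16 §6 (NE7 = NE7b + NE7c); records
`t4/T4-EST-U5bE2.md` v1.1 §3 S1–S4 (its v1.2 RETRACTS S3 after §2 below and keeps S1–S2), `t4/T4-EST-U5Ec-shells.md`
v1.1 §0(e), `t4/T4-REF-U5.md` (0.5); this seat's record `t4/T4-EST-NE7-P2.md`; kernel siblings `T4ShellMeasure` (the
threshold-averaging closure (δ) of NE7c: `exists_joint_common_threshold`, `exists_threshold_choice_function`,
`shellWeightBound_of_realized` — §6 below is its PRODUCT FORM), `T4IndicatorShell` (the shell slot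
`ShellWeightBound`), `T4NestedShells` (flattened shells with log-masses `L_K`), `T4WeightBudget` (`RelWeightBound`),
`T4GoodClassBudget` (the log window
`jlogOf C K ≤ j ≤ K` and its θ-sum `windowSum`), `T4BookingNecessity` (no size-only booking on the log window),
`T4MatchingClosure` (`hybridNE7_closure`, whose binders `hLs : Summable L` / `ShellWeightBound … Wsh` are the slot))

HONEST FRAMING (cell `pub-balaban`, T4-DAG PAGE 1).  The cell's T4 target is the existence AND uniqueness of the
continuum limit of Bałaban's unit-scale averaged loop expectations on a FINITE torus (rung (B)+1) — strictly beyond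
ultraviolet stability ([Balaban1989LargeFieldII] Thm 1 p. 355); it is NOT infinite volume, NOT the Yang–Mills mass gap
and NOT the Clay problem.  This module is bookkeeping arithmetic about the cell's own matching shapes; NOTHING of
Bałaban's estimates is proved or assumed here, every analytic input appears as an explicit hypothesis, and the module
does not decide NE7. [folklore arithmetic]

THE QUESTION (NE7c, the indicator-shell slot).  In the hybrid matching of the unit-scale densities of the two runs
(cutoffs `K` and `K+1`, synchronised couplings `g_j^{(K)} = ḡ(K−j)`), the terms of the one-run large-field expansion whose
small-field characteristic functions are evaluated at thresholds `ε(ḡ(K−j))` resp. `ε(ḡ(K+1−j))` differ on INDICATOR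
SHELLS; the kernel slot that absorbs them is `T4IndicatorShell.ShellWeightBound … Wsh` (fields `summable : Summable Wsh`
and, through `T4MatchingClosure.hybridNE7_closure'`, `W K + Wsh K < 1`), filled in the tree by the flattened nested
shells `Wsh K = 1 − e^{−L_K}` of `T4NestedShells.shellWeightBound_of_flattened` (binders `hL0`, `hLs : Summable L`).
The record `t4/T4-EST-U5bE2.md` §3 proposes to book the shells by SUPPRESSION ONLY: by [Balaban1989LargeFieldI] p. 193
a configuration in the shell violates the LOWER threshold, hence is a large-field configuration of the run with the
lower threshold and carries that run's small factor `exp(−p_deg(g_j))` (a degraded `p₀`-profile; hypothesis (H-sh-2) of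
§0(c) of that record, v1/v1.1: "NO GAIN from the thinness of the shell is claimed or needed" — a clause its v1.2 retracts
together with S3), and S3 (v1/v1.1) asserts that "Σ_K of the majorant converges under the same positivity of the
survival rate".  This seat's assigned technique is that weight route; the module records, as kernel
arithmetic, exactly how far it carries.

WHAT IS KERNEL-CHECKED.
* §1 WHERE THE SHELLS MUST BE BOOKED — GOOD TERMS ONLY.  Shells of terms already in NE7b's bad class cost nothing
  beyond `W`: if the shells of the GOOD terms `T K ∖ Bad K t` have relative mass `≤ Wg K` (summable), then
  `ShellWeightBound … (W + Wg)` (`shellWeightBound_of_good`); in the flattened packaging the same is achieved by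
  extending a core given on the good terms by `Acore := A` on the bad ones (`extendBad`, `extendBad_sandwich`,
  `extendBad_eq_of_not_mem`) — the core sandwich `hcore` of `T4NestedShells.cauchy_of_flattenedShells` only ever looks
  at `T K ∖ Bad K t`.  Consequently the shell slots that need booking are those of GOOD terms, i.e. (dictionary, not
  kernel) of small-field characteristic functions at the YOUNG levels `j ≥ K − N − O(1)` of the log window and at the
  final level `j = K`.
* §2 NECESSITY — SIZE-ONLY SHELL BOOKING IS NOT SUMMABLE IN `K`.  (a) Under the endpoint-normalised running
  `Step.Discrete031 b β′ K g (gs K)` the final coupling is `K`-INDEPENDENT: `gs K K ^ 2 = g ^ 2` (`sq_endpoint`, no sign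
  hypotheses), so `p₀(gs K K) = p₀(g)` (`p0Profile_endpoint`) and no weight sequence with a floor
  `c·exp(−p₀(gs K K)) ≤ Wsh K`, `c > 0`, is summable (`not_summable_of_finalScale_floor`; multiplicity form
  `not_summable_finalScale_size`); hence such a `Wsh` fits NO `ShellWeightBound` (`not_shellWeightBound_of_finalScale_floor`)
  and such an `L` cannot serve as the log-mass of `shellWeightBound_of_flattened` / `hybridNE7_closure` (their `hLs`).
  (b) On the whole log window the same holds by `T4BookingNecessity.not_summable_exp_neg_p0Profile_select`, re-exported
  here for a DEGRADED profile `c·p₀` (`p0Profile_smul`, `not_summable_windowLevel_size_degraded`), which is the shape of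
  the lowered-threshold factor of S2.  So S3 of `t4/T4-EST-U5bE2.md` does not follow from S1–S2: the shell slots of the
  good terms are YOUNG (no age for a survival rate to act on) and their one-run sizes have a positive floor at the final
  level and decay slower than any power of `K` on the window.
* §3 WHAT SUPPRESSION DOES SUPPLY — a UNIFORM budget: per-level masses bounded by sizes `S(K−j)` on a window of FIXED
  length `N₁` give `L_K ≤ T₁·Σ_{a ≤ N₁} Λ^a S(a)`, a `K`-independent constant (`windowMass_le_uniform`) — the currency of
  the slot's `lt_one`-type conditions (`W K + Wsh K < 1`), not of `Summable`.
* §4 SUFFICIENCY WITH A RATE, AND THE TWO-CURRENCY INTERPOLATION.  If the good-term shell mass at window level `j` is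
  `≤ D₀·θ^j` per slot (`0 < θ < 1`, a RATE in the level — U5b's currency) with `≤ T₁Λ^{K−j}` slots, the window log-mass
  `windowLogMass T₁ Λ C κ K = Σ_{jlogOf C K ≤ j ≤ K} T₁Λ^{K−j}κ_K(j)` is summable in `K` (`summable_windowLogMass_rate`, by
  `T4GoodClassBudget.summable_windowSum_log`).  More generally (`min_le_interpolate`: `min a b ≤ a^{1−α} b^{α}`), if each
  mass is bounded BOTH by a size `S(K−j)` and by a rate `D(K−j)·θ^j` whose density constant may be large, and the
  suppression pays for the density in the sense `S(a)^{1−α}·D(a)^{α} ≤ M` for some `0 < α ≤ 1`, then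
  `κ_K(j) ≤ M(θ^α)^j` (`twoCurrency_le`) and the window log-mass is again summable (`summable_windowLogMass_twoCurrency`),
  with nonnegativity (`windowLogMass_nonneg`) — exactly the binders `hL0`, `hLs` of `shellWeightBound_of_flattened` and
  `T4MatchingClosure.hybridNE7_closure` (`flattened_inputs_of_twoCurrency`).  This is the precise sense in which the
  weight route (B15/B16 suppression) CONTRIBUTES to `δ_K`: it cannot replace the rate, but it discounts the rate's
  density constant.
* §5 SANITY: the hypothesis sets of §2 and §4 are inhabited non-degenerately (`discrete031_const`,
  `twoCurrency_saturated`).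
* §6 (v1.1) PRODUCT FORM — SINGLE-RUN SUPPRESSION × THE THRESHOLD PIGEONHOLE.  In the sibling's closure (δ) the only
  weight input per run is own-coordinate disjointness of a slot's candidate shells against the TOTAL weight; since all
  candidates lie in the printed slack window, a lowered-threshold large-field event of the SAME run, they sum to at most
  `η_l ×` the total (`sum_shells_le_of_window`), and the joint pigeonhole gives level fractions `2ν_lη_l/n_l`
  (`exists_joint_common_threshold_suppressed`, `exists_threshold_choice_function_suppressed` — same output shape as the
  sibling's, consumed unchanged by `T4ShellMeasure.shellWeightBound_of_realized`).  Each run pays its OWN small factor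
  on its OWN window: no nesting of the two runs' large-field regions is needed (the row's recorded why-it-might-fail
  does not arise).  HONEST LABEL: this improves CONSTANTS only — under "suppression beats slot entropy on the live
  window"
  (`slotEntropy_le_of_suppression`, a smallness condition on `ḡ` of the printed type) the window entropy `Λ^{N₁}`
  leaves the constant (`levelFraction_le_of_suppressed`); the `K`-decay remains the rate's (§2, §4), and `η_l` slot-wise
  is NE7b's single-slot insertion species (E2), not printed.
* §7 (v1.2) THE ENTROPY MARGIN IS THE γ-CLAUSE.  Under the U5b owner's admitted design (η) (`T4LipschitzCutoff`) the
  shell slot's band weight is `Σ_{a ≤ N} n_a·lipWeight L_χ S ρ a K`, and the one positivity margin it asks (window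
  entropy `Λ^a L_χ(a)` × uniform width `ρ̄` against the suppression exponent — §6's `hP`, and per `K` the `lt_one` field
  of `T4MatchingAssembly.HybridNE7`) is DERIVED from the typed (2.5) (`B14.IsRj`), the window cap READING
  `N ≤ (1 + F)·R(ḡ)` ([Balaban1989LargeFieldI] p. 177 (ii), [Balaban1989LargeFieldII] p. 361), and the γ-clause shape of
  `T4PersistentHistoryCount.credit_dominates_window` (degree `r` of the window against degree `p₀ ≧ 5r` of the exponent):
  `margin_of_gammaClause`, along the run `margin_at_birthScales` (first member of (2.7),
  `T4ScalePairing.p0Profile_ge_infrared`), the band weight `≤ ε` at every `K` (`lipWeightSum_le_of_margin`,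
  `lipWeightSum_le_of_gammaClause`) and `W K + Wsh K < 1` (`lt_one_of_gammaClause`).  The margin is thereby removed from
  the list of independent NOT-PRINTED inputs of the weight route; the `K`-decay stays `ρ`'s ((F∞)) and `S` stays E2's.
  HONESTLY: under (η) the margin is constants-only (summability is free for any finite `C₀`, `lt_one` is free in the
  tail, `T4MatchingClosure.eventually_budget_lt_one`); the gain is ḡ-UNIFORM smallness at every `K` (no head shift).
  (v1.3) `margin_of_windowPow`: the print-shaped window READING `N ≤ D·(log ḡ⁻²)^ν` of [Balaban1989LargeFieldI] p. 198
  (after (1.94): the waiting window is a power `ν` of `log g_k⁻²`), γ-clause at degree `p₀ − ν`.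

WHAT IS NOT PRINTED / NOT ASSERTED (the exact missing inequality, typed as the hypotheses `hrate` / `hpay` of §4).  No
paper of the series compares two runs, and none bounds the MEASURE of a threshold shell
`{ε(ḡ(a+1)) ≤ |field| < ε(ḡ(a))}` under the step-`j` small-field densities by a RATE `θ^j` in the level (an
anti-concentration statement for the block-averaged plaquette variables at young levels); [Balaban1989LargeFieldI]
p. 193 and [Balaban1989LargeFieldII] (1.79) p. 383 give the SIZE currency only (§2 shows it is not summable in `K` by
itself).  That rate statement is the sibling row T4-U5b.E2-NE7c-PROVE-P1's assigned technique and is consumed here only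
as the abstract hypothesis shape `κ_K(j) ≤ D(K−j)·θ^j`; the alternative is the design decision (ii′) of
`T4IndicatorShell` (a common `K`-independent classifier on the young levels, no shell at all).  Neither is asserted.
Nor is the per-slot relative weight `η_l` of a lowered-threshold window in a frozen environment printed slot-wise (§6):
[Balaban1989LargeFieldI] p. 193 / [Balaban1989LargeFieldII] p. 383 give the small factor per large-field cube inside
ONE run's inductive bounds; its single-slot relative form is NE7b's E2 species and enters only as a hypothesis.
Nor (§7, v1.2) is the identification of the two-run bookkeeping's live AGE window with the printed waiting window `N`
of the R-operation, or its cap `N ≤ (1 + F)·R(ḡ)`, a quotation: [Balaban1989LargeFieldI] p. 177 (ii) and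
[Balaban1989LargeFieldII] p. 361 print the one-run window and «We have assumed here that N ≦ R_k.»; the two-run READING
is the cell's (`t4/T4-XREAD-U5c.md`) and enters §7 only as the hypothesis `hN`.  The γ-clause of §7 is a smallness
condition on `ḡ` with an explicit threshold — the species of the printed «if g_k is small enough» (p. 361), asserted by
no paper for the two-run comparison and by this file only as a hypothesis (`hγ`).

CITATION HEADER (LOCATORS ONLY — the sentences below were READ BY THIS SEAT on the rendered pages of the cell's page
store `b2b-balaban-ref1/pages/…` AS IMAGES on 2026-08-19; PDF page = journal page − 174 for CMP 122:175–202, − 354 for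
CMP 122:355–392, − 242 for CMP 119:243–285; nothing below is used as a hypothesis and nothing is quoted as authority).
* [Balaban1989LargeFieldI] T. Bałaban, *Large field renormalization. I. The basic step of the R operation*, Commun.
  Math. Phys. 122 (1989) 175–202: p. 193 [render p019]: "On the other hand, for any extension we have
  |∂U_{k,Z} − 1| ≧ 2ε_kη², hence 2ε_k < O(1)B₃M²ε, and |V_k(∂p′) − 1| > (O(1)B₃M²)^{−1}ε_k for some p′ ⊂ Z∩Λᶜ.  This
  condition is enough to get the exponential small factor, estimating in the usual way the Wilson action.  Thus
  1 − χ_{k,Λ} is a large field function, and we exclude from Z the components with this function." and "All the above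
  transformations preserve the k^{th} density ρ_k, they change only the representation of this density." — the
  LOWERED-THRESHOLD mechanism S1–S2 of `t4/T4-EST-U5bE2.md` (size currency, degraded constant `(O(1)B₃M²)^{−1}`);
  p. 181 [render p007]: "The restrictions in the function (1.22) imply that the characteristic functions (1.3) for j = h
  and □ ⊂ (Ω~_{h+1})ᶜ\Z_h are equal to 1." and "… for these we change the regularity conditions by a factor, which is a
  power of some number, the power being proportional to a number of overlapping regions." (changed thresholds cost a
  constant factor in the exponent — again the size currency); p. 177 [render p003]: "(ii) in the preceding N
  renormalization steps no new large field regions were created inside this component, and the previous regions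
  contained in it satisfy the condition (i) on the corresponding scales." and "Conditions on N will be formulated in
  constructions of this section." — the printed waiting window `N` of the R-operation (§7's window cap, READ as the live
  window of the two-run bookkeeping); p. 198 [render p024], after (1.94): "The last inequality holds under two
  restrictions on N. At first, we assume that N ≦ O(1)(log g_k^{−2})^ν ≦ O(1)(1 + β₀)(log g_h^{−2})^ν with a positive
  integer ν satisfying (1/2)ν ≦ p₀ − p₁ − 1. The second is that N has to be sufficiently large, so that the constant in
  the second term above can be bounded by (1/2)α. These two conditions can be satisfied by N to the positive power of
  log g_k^{−2}." — the window is printed as a POWER of `log g_k⁻²` (§7 `margin_of_windowPow`).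
* [Balaban1989LargeFieldII] T. Bałaban, *Large field renormalization. II. Localization, exponentiation, and bounds for
  the R operation*, Commun. Math. Phys. 122 (1989) 355–392: p. 383 [render p029]: "This is the largest factor among all
  the small factors we have obtained from the large field characteristic functions in the preparatory steps.  We assume
  that 2p₁ − (d + 5)r₀ > p₀, and we estimate the factors by exp(−p₀(g_j))." and "Finally, the summations over the
  admissible sequences can be replaced by the factors exp O(1)(MR_j)^{−d}|Z_j|." with (1.79) — the one-run SIZE
  `exp(−p₀(g_j))` per large-field characteristic function and the one-run entropy factor; p. 361 [render p007]: "term is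
  bounded by O(1)|B₀|δ′_k³ ≦ O(1)(100MR_k)^dN²δ′_k³ ≦ g_k³O(1)M^dR_k^{d+2}A₁³p₁³(g_k), and dividing the number on the
  right-hand side by g_k² we get still a small number, if g_k is small enough.  We have assumed here that N ≦ R_k." — the
  printed CAP of the waiting window by the (2.5)-window of the current coupling (§7); Thm 1 p. 355 (ultraviolet
  stability, the rung below the cell's target).
* [Balaban1988Convergent] T. Bałaban, *Convergent renormalization expansions for lattice gauge theories*, Commun. Math.
  Phys. 119 (1988) 243–285: p. 246 [render p004]: "in the first step we take ε₀ = g₀p₀(g₀), p₀(g₀) = A₀(log g₀⁻²)^{p₀},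
  p₀ ≧ 5r and A₀ is a sufficiently large constant." with the decompositions of unity (1.1), (1.4) into small-field /
  large-field characteristic functions — the tree's `p0Profile` (`Setup`) and the dictionary for "every good term carries
  small-field characteristic functions at every level, in particular at the final one".
* [Balaban1985AveragingFormulation] T. Bałaban, Commun. Math. Phys. 98 (1985) 17–51, (35) p. 30: the two-sided running
  behind `Step.Discrete031` (endpoint-normalised at the unit scale `k = K`, `gs K K = g`).
Consistency note: this module only ADDS hypotheses-to-conclusion arithmetic over the shapes of `T4IndicatorShell`,
`T4WeightBudget`, `T4NestedShells`, `T4GoodClassBudget`, `T4BookingNecessity`, `T4ShellMeasure` and (v1.2)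
`T4LipschitzCutoff`, `T4ScalePairing`, `B14`, `B14FlowStep`; it contradicts no tree fact and re-uses the tree's
`p0Profile`, `Step.Discrete031`, `jlogOf`, `windowSum`, `ShellWeightBound`, `RelWeightBound`, `candGrid`,
`exists_joint_choice_of_fibres`, `ageSum_le_geometric`, `sum_disjoint_shells_le` and (v1.2) `lipWeight`, `C0`, `CubeCount`,
`C0_le_of_cubeCount'`, `B14.IsRj`, `B14.FlowIneq27`, `B14FlowStep.isRj_le_mul_logpow`, `p0Profile_ge_infrared` by name
(the γ-clause shape of `T4PersistentHistoryCount.credit_dominates_window` is re-derived in three lines, not imported).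
v1.2 (unit `b2b-balaban-t4-ne7-p2` GEN 3): v1.1 declarations byte-identical; two imports and §7 appended.  v1.3 (same
seat): v1.2 declarations byte-identical; `margin_of_windowPow` + its sanity instance appended to §7, locator p. 198.
-/

namespace Literature.MathematicalPhysics.QuantumFieldTheory.Balaban1983to89.T4ShellSuppressionRoute

open Finset _root_.Filter _root_.Topology
open T4GoodClassBudget T4BookingNecessity T4IndicatorShell T4WeightBudget T4NestedShells

noncomputable section

/-! ## §1 Where the shells must be booked: good terms only -/

section GoodOnly

variable {ι : Type*} {l₀ : ℝ} {T : ℕ → Finset ι} {A B : ℕ → ℝ → ι → ℝ} {Bad : ℕ → ℝ → Finset ι}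

/-- **SHELLS OF BAD TERMS ARE FREE.**  Given NE7b's bad class with relative weights `W` (`RelWeightBound`, in particular
`Bad K t ⊆ T K` and `Σ_{Bad} X ≤ W_K·Σ_T X` for both runs `X = A, B`), shell pieces `0 ≤ shX ≤ X`, and a summable
relative bound `Wg` for the shells of the GOOD terms only, `Σ_{T K ∖ Bad K t} shX ≤ Wg_K·Σ_T X`, the shell slot of
`T4IndicatorShell.cauchy_of_relWeightBound_shell` is filled with weight `W + Wg`: on the bad terms `shX ≤ X` is charged
to `W`.  So only the good terms' shells — small-field slots at the young levels of the log window and at the final level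
— need a booking of their own. [folklore] -/
theorem shellWeightBound_of_good [DecidableEq ι] {shA shB : ℕ → ℝ → ι → ℝ} {W Wg : ℕ → ℝ}
    (hW : RelWeightBound l₀ T A B Bad W)
    (hA0 : ∀ K t, |t| ≤ l₀ → ∀ τ ∈ T K, 0 ≤ shA K t τ)
    (hAle : ∀ K t, |t| ≤ l₀ → ∀ τ ∈ T K, shA K t τ ≤ A K t τ)
    (hB0 : ∀ K t, |t| ≤ l₀ → ∀ τ ∈ T K, 0 ≤ shB K t τ)
    (hBle : ∀ K t, |t| ≤ l₀ → ∀ τ ∈ T K, shB K t τ ≤ B K t τ)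
    (hg0 : ∀ K, 0 ≤ Wg K) (hgs : Summable Wg)
    (hgA : ∀ K t, |t| ≤ l₀ → ∑ τ ∈ T K \ Bad K t, shA K t τ ≤ Wg K * ∑ τ ∈ T K, A K t τ)
    (hgB : ∀ K t, |t| ≤ l₀ → ∑ τ ∈ T K \ Bad K t, shB K t τ ≤ Wg K * ∑ τ ∈ T K, B K t τ) :
    ShellWeightBound l₀ T A B shA shB (fun K => W K + Wg K) where
  nonneg K := add_nonneg (hW.nonneg K) (hg0 K)
  summable := hW.summable.add hgs
  sh_nonneg_left := hA0
  sh_le_left := hAle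
  sh_nonneg_right := hB0
  sh_le_right := hBle
  left K t ht := by
    have hsub : Bad K t ⊆ T K := hW.bad_subset K t ht
    have e : ∑ τ ∈ T K, shA K t τ = ∑ τ ∈ T K \ Bad K t, shA K t τ + ∑ τ ∈ Bad K t, shA K t τ :=
      (Finset.sum_sdiff hsub).symm
    have hbad : ∑ τ ∈ Bad K t, shA K t τ ≤ W K * ∑ τ ∈ T K, A K t τ :=
      le_trans (sum_le_sum fun τ hτ => hAle K t ht τ (hsub hτ)) (hW.bad_left K t ht)
    rw [e]
    calc ∑ τ ∈ T K \ Bad K t, shA K t τ + ∑ τ ∈ Bad K t, shA K t τ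
        ≤ Wg K * ∑ τ ∈ T K, A K t τ + W K * ∑ τ ∈ T K, A K t τ := add_le_add (hgA K t ht) hbad
      _ = (W K + Wg K) * ∑ τ ∈ T K, A K t τ := by ring
  right K t ht := by
    have hsub : Bad K t ⊆ T K := hW.bad_subset K t ht
    have e : ∑ τ ∈ T K, shB K t τ = ∑ τ ∈ T K \ Bad K t, shB K t τ + ∑ τ ∈ Bad K t, shB K t τ :=
      (Finset.sum_sdiff hsub).symm
    have hbad : ∑ τ ∈ Bad K t, shB K t τ ≤ W K * ∑ τ ∈ T K, B K t τ :=
      le_trans (sum_le_sum fun τ hτ => hBle K t ht τ (hsub hτ)) (hW.bad_right K t ht)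
    rw [e]
    calc ∑ τ ∈ T K \ Bad K t, shB K t τ + ∑ τ ∈ Bad K t, shB K t τ
        ≤ Wg K * ∑ τ ∈ T K, B K t τ + W K * ∑ τ ∈ T K, B K t τ := add_le_add (hgB K t ht) hbad
      _ = (W K + Wg K) * ∑ τ ∈ T K, B K t τ := by ring

/-- The flattened-packaging form of "bad terms need no core": extend a core `Xcore′` given on the good terms by the
term itself on the bad class. [folklore] -/
def extendBad [DecidableEq ι] (Bad : ℕ → ℝ → Finset ι) (X Xcore' : ℕ → ℝ → ι → ℝ) : ℕ → ℝ → ι → ℝ :=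
  fun K t τ => if τ ∈ Bad K t then X K t τ else Xcore' K t τ

/-- On the bad class the extended core is the term itself. [folklore] -/
theorem extendBad_eq_of_mem [DecidableEq ι] {X Xcore' : ℕ → ℝ → ι → ℝ} {K : ℕ} {t : ℝ} {τ : ι}
    (h : τ ∈ Bad K t) : extendBad Bad X Xcore' K t τ = X K t τ := by
  simp [extendBad, h]

/-- Off the bad class the extended core is the given core. [folklore] -/
theorem extendBad_eq_of_not_mem [DecidableEq ι] {X Xcore' : ℕ → ℝ → ι → ℝ} {K : ℕ} {t : ℝ} {τ : ι}
    (h : τ ∉ Bad K t) : extendBad Bad X Xcore' K t τ = Xcore' K t τ := by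
  simp [extendBad, h]

/-- **ONLY GOOD TERMS NEED A CORE** (flattened packaging).  If the flattened sandwich
`0 ≤ Xcore′ ≤ X ≤ e^{L_K}·Xcore′` holds on the GOOD terms `T K ∖ Bad K t` and `X ≥ 0`, `L ≥ 0`, then the extended core
`extendBad Bad X Xcore′` satisfies the sandwich on ALL of `T K` with the same log-mass `L` — the binders `hA0/hAlo/hAhi`
(resp. `hB0/hBlo/hBhi`) of `T4NestedShells.shellWeightBound_of_flattened` and `T4MatchingClosure.hybridNE7_closure` —
and agrees with `Xcore′` off the bad class, where alone the core sandwich `hcore` is evaluated. [folklore] -/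
theorem extendBad_sandwich [DecidableEq ι] {X Xcore' : ℕ → ℝ → ι → ℝ} {L : ℕ → ℝ} (hL0 : ∀ K, 0 ≤ L K)
    (hX : ∀ K t, |t| ≤ l₀ → ∀ τ ∈ T K, 0 ≤ X K t τ)
    (h0 : ∀ K t, |t| ≤ l₀ → ∀ τ ∈ T K \ Bad K t, 0 ≤ Xcore' K t τ)
    (hlo : ∀ K t, |t| ≤ l₀ → ∀ τ ∈ T K \ Bad K t, Xcore' K t τ ≤ X K t τ)
    (hhi : ∀ K t, |t| ≤ l₀ → ∀ τ ∈ T K \ Bad K t, X K t τ ≤ Real.exp (L K) * Xcore' K t τ) :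
    (∀ K t, |t| ≤ l₀ → ∀ τ ∈ T K, 0 ≤ extendBad Bad X Xcore' K t τ) ∧
      (∀ K t, |t| ≤ l₀ → ∀ τ ∈ T K, extendBad Bad X Xcore' K t τ ≤ X K t τ) ∧
      (∀ K t, |t| ≤ l₀ → ∀ τ ∈ T K, X K t τ ≤ Real.exp (L K) * extendBad Bad X Xcore' K t τ) := by
  refine ⟨fun K t ht τ hτ => ?_, fun K t ht τ hτ => ?_, fun K t ht τ hτ => ?_⟩
  · by_cases h : τ ∈ Bad K t
    · rw [extendBad_eq_of_mem h]; exact hX K t ht τ hτ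
    · rw [extendBad_eq_of_not_mem h]; exact h0 K t ht τ (mem_sdiff.2 ⟨hτ, h⟩)
  · by_cases h : τ ∈ Bad K t
    · rw [extendBad_eq_of_mem h]
    · rw [extendBad_eq_of_not_mem h]; exact hlo K t ht τ (mem_sdiff.2 ⟨hτ, h⟩)
  · by_cases h : τ ∈ Bad K t
    · rw [extendBad_eq_of_mem h]
      exact le_mul_of_one_le_left (hX K t ht τ hτ) (Real.one_le_exp (hL0 K))
    · rw [extendBad_eq_of_not_mem h]; exact hhi K t ht τ (mem_sdiff.2 ⟨hτ, h⟩)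

/-- The core sandwich on the good classes is insensitive to the extension. [folklore] -/
theorem extendBad_core [DecidableEq ι] {Acore' Bcore' : ℕ → ℝ → ι → ℝ} {vol : ℝ} {δ : ℕ → ℝ}
    (hcore : ∀ K : ℕ, ∃ c : ℝ, ∀ t : ℝ, |t| ≤ l₀ → ∀ τ ∈ T K \ Bad K t,
      Real.exp (c - vol * δ K) * Acore' K t τ ≤ Bcore' K t τ ∧
        Bcore' K t τ ≤ Real.exp (c + vol * δ K) * Acore' K t τ) :
    ∀ K : ℕ, ∃ c : ℝ, ∀ t : ℝ, |t| ≤ l₀ → ∀ τ ∈ T K \ Bad K t,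
      Real.exp (c - vol * δ K) * extendBad Bad A Acore' K t τ ≤ extendBad Bad B Bcore' K t τ ∧
        extendBad Bad B Bcore' K t τ ≤ Real.exp (c + vol * δ K) * extendBad Bad A Acore' K t τ := by
  intro K
  obtain ⟨c, hc⟩ := hcore K
  refine ⟨c, fun t ht τ hτ => ?_⟩
  have h : τ ∉ Bad K t := (mem_sdiff.1 hτ).2
  rw [extendBad_eq_of_not_mem h, extendBad_eq_of_not_mem h]
  exact hc t ht τ hτ

end GoodOnly

/-! ## §2 Necessity: size-only shell booking is not summable in `K` -/

section Necessity

variable {b β' g : ℝ}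

/-- Under the endpoint-normalised two-sided running `Step.Discrete031 b β′ K g gs` (both bounds taken at `k = K`, where
`(K : ℝ) − K = 0`) the final inverse coupling is pinned: `1/(gs K)² = 1/g²`.  No sign hypotheses. [folklore] -/
theorem inv_sq_endpoint {K : ℕ} {gs : ℕ → ℝ} (h : Step.Discrete031 b β' K g gs) : 1 / gs K ^ 2 = 1 / g ^ 2 := by
  have h1 := h K le_rfl
  simp only [sub_self, mul_zero, add_zero] at h1
  exact le_antisymm h1.2 h1.1

/-- … hence `(gs K)² = g²`: the final (unit-scale) coupling of every run is the SAME number `g`. [folklore] -/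
theorem sq_endpoint {K : ℕ} {gs : ℕ → ℝ} (h : Step.Discrete031 b β' K g gs) : gs K ^ 2 = g ^ 2 := by
  have e := inv_sq_endpoint h
  rw [one_div, one_div] at e
  exact inv_inj.1 e

/-- … hence the final small-field profile is `K`-independent: `p₀(gs K) = p₀(g)` (`p0Profile` depends on `g²` only).
[folklore] -/
theorem p0Profile_endpoint (A₀ : ℝ) (p₀ : ℕ) {K : ℕ} {gs : ℕ → ℝ} (h : Step.Discrete031 b β' K g gs) :
    p0Profile A₀ p₀ (gs K) = p0Profile A₀ p₀ g := by
  unfold p0Profile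
  rw [sq_endpoint h]

/-- The DEGRADED profile of the lowered-threshold mechanism ([Balaban1989LargeFieldI] p. 193: threshold constant
`(O(1)B₃M²)^{−1}`) is again a `p₀`-profile: `p0Profile (c·A₀) p₀ = c·p0Profile A₀ p₀`. [folklore] -/
theorem p0Profile_smul (c A₀ : ℝ) (p₀ : ℕ) (x : ℝ) : p0Profile (c * A₀) p₀ x = c * p0Profile A₀ p₀ x := by
  unfold p0Profile
  ring

/-- Tool: a sequence with an eventual positive floor is not summable. [folklore] -/
theorem not_summable_of_floor {f : ℕ → ℝ} {c : ℝ} (hc : 0 < c) (h : ∀ᶠ K in atTop, c ≤ f K) : ¬ Summable f := by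
  intro hf
  have h1 : ∀ᶠ K in atTop, f K < c := (tendsto_order.1 hf.tendsto_atTop_zero).2 c hc
  obtain ⟨K, hK1, hK2⟩ := (h1.and h).exists
  exact absurd hK2 (not_le.2 hK1)

/-- **NO SIZE-ONLY BOOKING OF THE FINAL-LEVEL SHELL.**  Along any family of endpoint-normalised runs
(`Step.Discrete031 b β′ K g (gs K)` for every cutoff `K`), a weight sequence bounded BELOW by a positive multiple of
the final-level one-run size `exp(−p₀(gs K K))` — which by `p0Profile_endpoint` is the CONSTANT `exp(−p₀(g)) > 0` — is not
summable in `K`.  Dictionary: every good term of the one-run expansion carries small-field characteristic functions at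
the final level ([Balaban1988Convergent] (1.1) p. 246); their shells, booked by the lowered-threshold suppression of
[Balaban1989LargeFieldI] p. 193 alone, contribute at least `c·exp(−p_deg(g))` to `Wsh K` for every `K`. [folklore] -/
theorem not_summable_of_finalScale_floor (A₀ : ℝ) (p₀ : ℕ) {gs : ℕ → ℕ → ℝ}
    (h031 : ∀ K, Step.Discrete031 b β' K g (gs K)) {c : ℝ} (hc : 0 < c) {Wsh : ℕ → ℝ}
    (hfloor : ∀ K, c * Real.exp (-(p0Profile A₀ p₀ (gs K K))) ≤ Wsh K) : ¬ Summable Wsh :=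
  not_summable_of_floor (mul_pos hc (Real.exp_pos (-(p0Profile A₀ p₀ g))))
    (Eventually.of_forall fun K => by
      have h := hfloor K
      rwa [p0Profile_endpoint A₀ p₀ (h031 K)] at h)

/-- Multiplicity form (the shape of `T4BookingNecessity.not_summable_exp_neg_p0Profile_select`, at the final level
`sel K = K`, with NO hypotheses on `b, β′, g, A₀`): `Σ_K m_K·exp(−p₀(gs K K)) = ∞` for multiplicities `m_K ≥ 1`.
[folklore] -/
theorem not_summable_finalScale_size (A₀ : ℝ) (p₀ : ℕ) {gs : ℕ → ℕ → ℝ}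
    (h031 : ∀ K, Step.Discrete031 b β' K g (gs K)) {m : ℕ → ℝ} (hm : ∀ K, 1 ≤ m K) :
    ¬ Summable (fun K => m K * Real.exp (-(p0Profile A₀ p₀ (gs K K)))) :=
  not_summable_of_finalScale_floor A₀ p₀ h031 one_pos fun K => by
    rw [one_mul]
    exact le_mul_of_one_le_left (Real.exp_nonneg _) (hm K)

/-- **CONSEQUENCE FOR THE SHELL SLOT.**  A weight sequence with the final-level size floor fits NO
`T4IndicatorShell.ShellWeightBound` (whatever the terms, runs and shells), because that shape demands `Summable Wsh`;
likewise it cannot be the log-mass `L` of `T4NestedShells.shellWeightBound_of_flattened` /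
`T4MatchingClosure.hybridNE7_closure` (binder `hLs : Summable L`) nor a level weight `w ℓ` of
`T4NestedShells.shellWeightBound_of_levels` (each level's `ShellWeightBound` needs `Summable (w ℓ)`). [folklore] -/
theorem not_shellWeightBound_of_finalScale_floor {ι : Type*} {l₀ : ℝ} {T : ℕ → Finset ι}
    {A B shA shB : ℕ → ℝ → ι → ℝ} (A₀ : ℝ) (p₀ : ℕ) {gs : ℕ → ℕ → ℝ}
    (h031 : ∀ K, Step.Discrete031 b β' K g (gs K)) {c : ℝ} (hc : 0 < c) {Wsh : ℕ → ℝ}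
    (hfloor : ∀ K, c * Real.exp (-(p0Profile A₀ p₀ (gs K K))) ≤ Wsh K) :
    ¬ ShellWeightBound l₀ T A B shA shB Wsh :=
  fun h => not_summable_of_finalScale_floor A₀ p₀ h031 hc hfloor h.summable

variable {C : ℝ}

/-- **NO SIZE-ONLY BOOKING ANYWHERE ON THE LOG WINDOW, DEGRADED PROFILE.**  Re-export of
`T4BookingNecessity.not_summable_exp_neg_p0Profile_select` for the lowered-threshold factor `exp(−c·p₀(g_j))`
(`c ≥ 0`; by `p0Profile_smul` this is `exp(−p0Profile (c·A₀) p₀ (g_j))`): along asymptotic freedom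
(`Step.Discrete031`, `b, β′ ≥ 0`, `0 < g ≤ 1`) no selection `jlogOf C K ≤ sel K ≤ K` of window levels with
multiplicities `≥ 1` has `Σ_K m_K·exp(−c·p₀(gs K (sel K))) < ∞`. [folklore] -/
theorem not_summable_windowLevel_size_degraded {A₀ c : ℝ} (hA : 0 ≤ A₀) (hc : 0 ≤ c) (p₀ : ℕ) (hb : 0 ≤ b)
    (hβ : 0 ≤ β') (hg : 0 < g) (hg1 : g ≤ 1) (hC : 0 ≤ C) {gs : ℕ → ℕ → ℝ}
    (h031 : ∀ K, Step.Discrete031 b β' K g (gs K)) {sel : ℕ → ℕ} (hsel : ∀ K, jlogOf C K ≤ sel K ∧ sel K ≤ K)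
    {m : ℕ → ℝ} (hm : ∀ K, 1 ≤ m K) :
    ¬ Summable (fun K => m K * Real.exp (-(c * p0Profile A₀ p₀ (gs K (sel K))))) := by
  have h := not_summable_exp_neg_p0Profile_select (mul_nonneg hc hA) p₀ hb hβ hg hg1 hC h031 hsel hm
  simpa only [p0Profile_smul] using h

end Necessity

/-! ## §3 What suppression does supply: a uniform budget -/

section Uniform

/-- Reindexing a window of fixed length by age `a = K − j`. [folklore] -/
theorem sum_Icc_sub_eq_sum_range {N₁ K : ℕ} (hN : N₁ ≤ K) (f : ℕ → ℝ) :
    ∑ j ∈ Icc (K - N₁) K, f (K - j) = ∑ a ∈ range (N₁ + 1), f a := by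
  refine Finset.sum_nbij' (fun j => K - j) (fun a => K - a) ?_ ?_ ?_ ?_ ?_
  · intro j hj
    simp only [mem_Icc] at hj
    simp only [mem_range]
    omega
  · intro a ha
    simp only [mem_range] at ha
    simp only [mem_Icc]
    omega
  · intro j hj
    simp only [mem_Icc] at hj
    omega
  · intro a ha
    simp only [mem_range] at ha
    omega
  · intro j _
    rfl

/-- **SUPPRESSION GIVES A UNIFORM BUDGET, NOT A SUMMABLE ONE.**  If the per-level masses on a window of FIXED length
`N₁` (the young levels `K − N₁ ≤ j ≤ K`) are bounded by one-run sizes `S(K − j) ≥ 0` depending on the AGE only (as the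
lowered-threshold factors `exp(−p_deg(ḡ(K−j)))` do under synchronised couplings), with `≤ T₁Λ^{K−j}` slots per level,
then the window mass is bounded by the `K`-INDEPENDENT constant `T₁·Σ_{a ≤ N₁} Λ^a·S(a)` — the currency of the slot's
`W K + Wsh K < 1` condition (`T4MatchingClosure.hybridNE7_closure'`, binder `hlt`), not of `Summable Wsh`. [folklore] -/
theorem windowMass_le_uniform {T₁ Λ : ℝ} (hT : 0 ≤ T₁) (hΛ : 0 ≤ Λ) {N₁ K : ℕ} (hN : N₁ ≤ K) {S : ℕ → ℝ}
    {κ : ℕ → ℕ → ℝ} (hsize : ∀ j, K - N₁ ≤ j → j ≤ K → κ K j ≤ S (K - j)) :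
    ∑ j ∈ Icc (K - N₁) K, T₁ * Λ ^ (K - j) * κ K j ≤ T₁ * ∑ a ∈ range (N₁ + 1), Λ ^ a * S a := by
  rw [← sum_Icc_sub_eq_sum_range hN (fun a => Λ ^ a * S a), Finset.mul_sum]
  refine sum_le_sum fun j hj => ?_
  have hj' := mem_Icc.1 hj
  calc T₁ * Λ ^ (K - j) * κ K j ≤ T₁ * Λ ^ (K - j) * S (K - j) :=
        mul_le_mul_of_nonneg_left (hsize j hj'.1 hj'.2) (mul_nonneg hT (pow_nonneg hΛ _))
    _ = T₁ * (Λ ^ (K - j) * S (K - j)) := by ring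

end Uniform

/-! ## §4 Sufficiency with a rate; the two-currency interpolation -/

section TwoCurrency

/-- Interpolation between two upper bounds: `min a b ≤ a^{1−α}·b^{α}` for `a, b ≥ 0`, `0 ≤ α ≤ 1` (real powers).
[folklore] -/
theorem min_le_interpolate {a b α : ℝ} (ha : 0 ≤ a) (hb : 0 ≤ b) (hα0 : 0 ≤ α) (hα1 : α ≤ 1) :
    min a b ≤ a ^ (1 - α) * b ^ α := by
  have hne : (1 - α) + α ≠ 0 := by
    rw [sub_add_cancel]
    exact one_ne_zero
  rcases le_total a b with hab | hab
  · rw [min_eq_left hab]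
    have e : a ^ (1 - α) * a ^ α = a := by
      rw [← Real.rpow_add' ha hne, sub_add_cancel, Real.rpow_one]
    calc a = a ^ (1 - α) * a ^ α := e.symm
      _ ≤ a ^ (1 - α) * b ^ α :=
          mul_le_mul_of_nonneg_left (Real.rpow_le_rpow ha hab hα0) (Real.rpow_nonneg ha _)
  · rw [min_eq_right hab]
    have e : b ^ (1 - α) * b ^ α = b := by
      rw [← Real.rpow_add' hb hne, sub_add_cancel, Real.rpow_one]
    calc b = b ^ (1 - α) * b ^ α := e.symm
      _ ≤ a ^ (1 - α) * b ^ α :=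
          mul_le_mul_of_nonneg_right (Real.rpow_le_rpow hb hab (by linarith)) (Real.rpow_nonneg hb _)

/-- `(θ^j)^α = (θ^α)^j` for `θ ≥ 0` (natural power inside, real power outside). [folklore] -/
theorem pow_rpow_comm {θ : ℝ} (hθ : 0 ≤ θ) (j : ℕ) (α : ℝ) : (θ ^ j) ^ α = (θ ^ α) ^ j := by
  rw [← Real.rpow_natCast θ j, ← Real.rpow_mul hθ, mul_comm, Real.rpow_mul hθ, Real.rpow_natCast]

/-- **TWO CURRENCIES, ONE RATE.**  A mass bounded both by a SIZE `s ≥ 0` (suppression) and by a RATE `d·θ^j` with a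
possibly large density constant `d ≥ 0` satisfies `κ ≤ M·(θ^α)^j` as soon as the suppression pays for the density,
`s^{1−α}·d^{α} ≤ M` (`0 ≤ α ≤ 1`).  With `α = 1` this is the pure rate; small `α` trades almost all of the rate for the
right to have `d` huge, provided `s` is correspondingly tiny. [folklore] -/
theorem twoCurrency_le {s d θ κ M α : ℝ} (j : ℕ) (hs : 0 ≤ s) (hd : 0 ≤ d) (hθ : 0 ≤ θ) (hα0 : 0 ≤ α)
    (hα1 : α ≤ 1) (h1 : κ ≤ s) (h2 : κ ≤ d * θ ^ j) (hpay : s ^ (1 - α) * d ^ α ≤ M) :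
    κ ≤ M * (θ ^ α) ^ j :=
  calc κ ≤ min s (d * θ ^ j) := le_min h1 h2
    _ ≤ s ^ (1 - α) * (d * θ ^ j) ^ α := min_le_interpolate hs (mul_nonneg hd (pow_nonneg hθ j)) hα0 hα1
    _ = s ^ (1 - α) * d ^ α * (θ ^ α) ^ j := by
        rw [Real.mul_rpow hd (pow_nonneg hθ j), pow_rpow_comm hθ j α, mul_assoc]
    _ ≤ M * (θ ^ α) ^ j := mul_le_mul_of_nonneg_right hpay (pow_nonneg (Real.rpow_nonneg hθ α) j)

/-- The WINDOW LOG-MASS of the good-term shells: `Σ_{jlogOf C K ≤ j ≤ K} T₁·Λ^{K−j}·κ_K(j)` — per window level `j`,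
at most `T₁Λ^{K−j}` shell slots (U5c's recent-window term budget, `T4GoodClassBudget`) of mass `κ_K(j)` each.  This is
the candidate for the binder `L` of `T4NestedShells.shellWeightBound_of_flattened` / `T4MatchingClosure.hybridNE7_closure`
once §1 has discharged the bad terms. [folklore] -/
def windowLogMass (T₁ Λ C : ℝ) (κ : ℕ → ℕ → ℝ) (K : ℕ) : ℝ :=
  ∑ j ∈ Icc (jlogOf C K) K, T₁ * Λ ^ (K - j) * κ K j

/-- The window log-mass is nonnegative for nonnegative masses (binder `hL0`). [folklore] -/
theorem windowLogMass_nonneg {T₁ Λ C : ℝ} (hT : 0 ≤ T₁) (hΛ : 0 ≤ Λ) {κ : ℕ → ℕ → ℝ} (hκ0 : ∀ K j, 0 ≤ κ K j)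
    (K : ℕ) : 0 ≤ windowLogMass T₁ Λ C κ K :=
  sum_nonneg fun j _ => mul_nonneg (mul_nonneg hT (pow_nonneg hΛ _)) (hκ0 K j)

/-- Comparison of the window log-mass with a θ′-window sum. [folklore] -/
theorem windowLogMass_le_windowSum {T₁ Λ C M θ' : ℝ} (hT : 0 ≤ T₁) (hΛ : 0 ≤ Λ) {κ : ℕ → ℕ → ℝ}
    (hκ : ∀ K j, jlogOf C K ≤ j → j ≤ K → κ K j ≤ M * θ' ^ j) (K : ℕ) :
    windowLogMass T₁ Λ C κ K ≤ T₁ * M * windowSum θ' Λ (jlogOf C K) K := by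
  unfold windowLogMass windowSum
  rw [Finset.mul_sum]
  refine sum_le_sum fun j hj => ?_
  have hj' := mem_Icc.1 hj
  calc T₁ * Λ ^ (K - j) * κ K j ≤ T₁ * Λ ^ (K - j) * (M * θ' ^ j) :=
        mul_le_mul_of_nonneg_left (hκ K j hj'.1 hj'.2) (mul_nonneg hT (pow_nonneg hΛ _))
    _ = T₁ * M * (θ' ^ j * Λ ^ (K - j)) := by ring

/-- **SUFFICIENCY WITH A RATE** (U5b's currency, the sibling row NE7c-P1's target shape): if the good-term shell mass
per slot at window level `j` is `≤ D₀·θ^j` with `0 < θ < 1 ≤ Λ`, the window log-mass is summable in `K` — by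
`T4GoodClassBudget.summable_windowSum_log` (`Σ_K Σ_{window} θ^jΛ^{K−j} < ∞`, the log window being short).  NOT PRINTED:
the rate hypothesis `hrate` itself. [folklore] -/
theorem summable_windowLogMass_rate {θ Λ C T₁ D₀ : ℝ} (hθ : 0 < θ) (hθ1 : θ < 1) (hΛ : 1 ≤ Λ) (hC : 0 ≤ C)
    (hT : 0 ≤ T₁) {κ : ℕ → ℕ → ℝ} (hκ0 : ∀ K j, 0 ≤ κ K j)
    (hrate : ∀ K j, jlogOf C K ≤ j → j ≤ K → κ K j ≤ D₀ * θ ^ j) :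
    Summable (windowLogMass T₁ Λ C κ) :=
  Summable.of_nonneg_of_le (windowLogMass_nonneg hT (by linarith) hκ0)
    (windowLogMass_le_windowSum hT (by linarith) hrate)
    ((summable_windowSum_log hθ hθ1 hΛ hC).mul_left (T₁ * D₀))

/-- **SUFFICIENCY WITH TWO CURRENCIES.**  Per window level `j` of age `a = K − j`, let the good-term shell mass per
slot be bounded by a SIZE `S(a) ≥ 0` (the lowered-threshold suppression, B15 p. 193 / B16 (1.79)) AND by a RATE
`D(a)·θ^j` (`D ≥ 0`, `0 < θ < 1`), and let the suppression pay for the density constants: `S(a)^{1−α}·D(a)^{α} ≤ M`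
for some `0 < α ≤ 1`.  Then the window log-mass is summable in `K` (rate `θ^α`, `summable_windowSum_log`).  The weight
route's exact contribution to `δ_K`: it cannot replace the rate (§2) but it discounts the rate's constant. [folklore] -/
theorem summable_windowLogMass_twoCurrency {θ Λ C T₁ M α : ℝ} (hθ : 0 < θ) (hθ1 : θ < 1) (hΛ : 1 ≤ Λ)
    (hC : 0 ≤ C) (hT : 0 ≤ T₁) (hα0 : 0 < α) (hα1 : α ≤ 1) {S D : ℕ → ℝ} {κ : ℕ → ℕ → ℝ}
    (hS0 : ∀ a, 0 ≤ S a) (hD0 : ∀ a, 0 ≤ D a) (hκ0 : ∀ K j, 0 ≤ κ K j)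
    (hsize : ∀ K j, jlogOf C K ≤ j → j ≤ K → κ K j ≤ S (K - j))
    (hrate : ∀ K j, jlogOf C K ≤ j → j ≤ K → κ K j ≤ D (K - j) * θ ^ j)
    (hpay : ∀ a, S a ^ (1 - α) * D a ^ α ≤ M) :
    Summable (windowLogMass T₁ Λ C κ) := by
  have hθα0 : 0 < θ ^ α := Real.rpow_pos_of_pos hθ α
  have hθα1 : θ ^ α < 1 := Real.rpow_lt_one hθ.le hθ1 hα0
  have hκ : ∀ K j, jlogOf C K ≤ j → j ≤ K → κ K j ≤ M * (θ ^ α) ^ j := fun K j h1 h2 =>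
    twoCurrency_le j (hS0 (K - j)) (hD0 (K - j)) hθ.le hα0.le hα1 (hsize K j h1 h2) (hrate K j h1 h2)
      (hpay (K - j))
  exact Summable.of_nonneg_of_le (windowLogMass_nonneg hT (by linarith) hκ0)
    (windowLogMass_le_windowSum hT (by linarith) hκ)
    ((summable_windowSum_log hθα0 hθα1 hΛ hC).mul_left (T₁ * M))

/-- THE PLUG, BY NAME: under the two-currency hypotheses the window log-mass `L := windowLogMass T₁ Λ C κ` supplies
EXACTLY the binders `hL0 : ∀ K, 0 ≤ L K` and `hLs : Summable L` of `T4NestedShells.shellWeightBound_of_flattened`,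
`T4NestedShells.cauchy_of_flattenedShells` and `T4MatchingClosure.hybridNE7_closure` (whose remaining binders — the
flattened sandwiches with this `L`, NE7b's `RelWeightBound`/`SlotDom`, the core sandwich — are the other rows' and are
not touched here). [folklore] -/
theorem flattened_inputs_of_twoCurrency {θ Λ C T₁ M α : ℝ} (hθ : 0 < θ) (hθ1 : θ < 1) (hΛ : 1 ≤ Λ)
    (hC : 0 ≤ C) (hT : 0 ≤ T₁) (hα0 : 0 < α) (hα1 : α ≤ 1) {S D : ℕ → ℝ} {κ : ℕ → ℕ → ℝ}
    (hS0 : ∀ a, 0 ≤ S a) (hD0 : ∀ a, 0 ≤ D a) (hκ0 : ∀ K j, 0 ≤ κ K j)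
    (hsize : ∀ K j, jlogOf C K ≤ j → j ≤ K → κ K j ≤ S (K - j))
    (hrate : ∀ K j, jlogOf C K ≤ j → j ≤ K → κ K j ≤ D (K - j) * θ ^ j)
    (hpay : ∀ a, S a ^ (1 - α) * D a ^ α ≤ M) :
    (∀ K, 0 ≤ windowLogMass T₁ Λ C κ K) ∧ Summable (windowLogMass T₁ Λ C κ) :=
  ⟨windowLogMass_nonneg hT (by linarith) hκ0,
    summable_windowLogMass_twoCurrency hθ hθ1 hΛ hC hT hα0 hα1 hS0 hD0 hκ0 hsize hrate hpay⟩

end TwoCurrency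

/-! ## §5 Sanity: the hypothesis sets are inhabited non-degenerately -/

section Sanity

/-- The constant coupling family satisfies the endpoint-normalised running with `b = β′ = 0`; so the hypothesis
`h031` of §2 is inhabited and `not_summable_finalScale_size` is not vacuous (e.g. `m = 1`). [folklore] -/
theorem discrete031_const (g : ℝ) (K : ℕ) : Step.Discrete031 0 0 K g (fun _ => g) := by
  intro k _
  simp

example (A₀ g : ℝ) (p₀ : ℕ) : ¬ Summable (fun K : ℕ => (1 : ℝ) * Real.exp (-(p0Profile A₀ p₀ ((fun _ _ => g) K K)))) :=
  not_summable_finalScale_size (b := 0) (β' := 0) A₀ p₀ (fun K => discrete031_const g K) fun _ => le_rfl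

/-- The SATURATED two-currency masses `κ_K(j) = min (S(K−j)) (D(K−j)·θ^j)` satisfy `hκ0`, `hsize`, `hrate` of
`summable_windowLogMass_twoCurrency`; with `S(a) = e^{−a}`, `D(a) = e^{a}`, `α = 1/2`, `M = 1` also `hpay`
(`e^{−a/2}·e^{a/2} = 1`): unbounded density constants paid for by the suppression. [folklore] -/
theorem twoCurrency_saturated {θ : ℝ} (hθ : 0 ≤ θ) (S D : ℕ → ℝ) (hS0 : ∀ a, 0 ≤ S a) (hD0 : ∀ a, 0 ≤ D a) :
    let κ : ℕ → ℕ → ℝ := fun K j => min (S (K - j)) (D (K - j) * θ ^ j)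
    (∀ K j, 0 ≤ κ K j) ∧ (∀ K j, κ K j ≤ S (K - j)) ∧ (∀ K j, κ K j ≤ D (K - j) * θ ^ j) :=
  ⟨fun _ j => le_min (hS0 _) (mul_nonneg (hD0 _) (pow_nonneg hθ j)), fun _ _ => min_le_left _ _,
    fun _ _ => min_le_right _ _⟩

example (a : ℕ) : Real.exp (-(a : ℝ)) ^ (1 - (1 / 2 : ℝ)) * Real.exp (a : ℝ) ^ (1 / 2 : ℝ) ≤ 1 := by
  rw [Real.exp_neg, Real.inv_rpow (Real.exp_nonneg _), show (1 - (1 / 2 : ℝ)) = 1 / 2 by norm_num,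
    inv_mul_cancel₀ (ne_of_gt (Real.rpow_pos_of_pos (Real.exp_pos _) _))]

end Sanity

/-! ## §6 Product form: single-run suppression × the threshold pigeonhole (v1.1)

Dictionary (not kernel).  The fan-out row T4-U5.E-NE7-PROVE-P2* reads the weight route as "the shell part costs
(shell measure, NE7c) × (suppression)", with the why-it-might-fail "a TWO-RUN suppression needs the runs' large-field
regions nested up to the shell".  In the threshold-averaging closure of the sibling module `T4ShellMeasure` §6–§7
(grounding (δ): `exists_joint_common_threshold`, `exists_threshold_choice_function`, consumed by
`SlotLedger.of_realized` / `shellWeightBound_of_realized`) the only weight input per run is OWN-COORDINATE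
DISJOINTNESS `Σ_m fA l s (update c l m) ≤ Z^A`: the `n_l` candidate shells of slot `s` are pairwise disjoint events,
so their weights sum to at most the TOTAL weight.  But every candidate shell of slot `s` lies inside the printed slack
window `[θ(1 − β′), θ)` (`T4ShellMeasure.candShell_subset_slack`), and a configuration in that window violates the
regularity condition with the LOWERED threshold `θ(1 − β′)` of the SAME run (S1 of `t4/T4-EST-U5bE2.md` §3, the
mechanism of [Balaban1989LargeFieldI] p. 193 quoted in the header); so the candidates' weights sum to at most the
weight of that one-run large-field event, `≤ η_l·Z^A` (`sum_shells_le_of_window`; hypotheses `hA`/`hB` of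
`exists_joint_common_threshold_suppressed`).  EACH RUN PAYS ITS OWN single-run small factor on its OWN slack window;
the two runs' large-field regions are never compared, let alone nested — in this product form the why-it-might-fail of
the row does not arise.  The pigeonhole then yields level fractions `2ν_lη_l/n_l` instead of `2ν_l/n_l`
(`exists_joint_common_threshold_suppressed`; per `K`, `exists_threshold_choice_function_suppressed`, with OUTPUT SHAPE
IDENTICAL to the sibling's `exists_threshold_choice_function`, hence consumed unchanged by
`T4ShellMeasure.SlotLedger.of_realized` / `shellWeightBound_of_realized`).
WHAT THIS BUYS, HONESTLY — CONSTANTS, NOT CONVERGENCE.  On the bounded live window (ages `a ≤ N₁`, (W1)) the slot count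
`ν_a ≤ v₀Λ^a` carries the window entropy `Λ^{N₁}` into the sibling's constant `M = ν̄D̄c₁`, `ν̄ = v₀Λ^{N₁}`
(`T4ShellMeasure.levelFraction_le_of_rate`).  If suppression beats slot entropy on the window — `η_a ≤ e^{−P(a)}` with
`a·log Λ ≤ P(a)` for `a ≤ N₁`, a smallness condition on `ḡ` of the printed TYPE (on [Balaban1989LargeFieldII] p. 383 the
one-run small factors `exp(−p₀(g_j))` and the one-run counting factors `exp O(1)(MR_j)^{−d}|Z_j|` of (1.79) stand side
by side; that a `p₀`-type exponent dominates `N₁·log Λ` is a condition on `ḡ`, recorded as the hypothesis `hP`, not a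
quotation) — then `ν_aη_a ≤ v₀` (`slotEntropy_le_of_suppression`) and the constant becomes `v₀D̄c₁`, free of `Λ^{N₁}`
(`levelFraction_le_of_suppressed`).  The `K`-decay `ϑ^K` is still the RATE's (`2/n_a ≤ D̄ρ_{K,a}` by the candidate
count, `ρ_{K,a} ≤ c₁ϑ^{K−a}` = the (F∞)-rate, NOT PRINTED, NE3 species), exactly as §2 and §4 say; and `η_l` is NOT
printed slot-wise either — the relative weight of ONE slot's lowered-threshold window in a frozen environment is NE7b's
single-slot insertion species (E2 of `t4/T4-REF-U5.md`), entering here only as the hypothesis shape `≤ η_l·Z`.  With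
`η ≡ 1` every statement below specialises to the sibling's. [folklore arithmetic] -/

section ProductForm

open T4ShellMeasure

/-- CANDIDATE SHELLS INSIDE ONE WINDOW: pairwise disjoint events `E i ⊆ W` (`i < n`) of nonnegative pointwise weight
sum to at most the weight of the window event `W` (`T4ShellMeasure.sum_disjoint_shells_le` on `T ∩ W`); if the window
is a large-field event of relative weight `η` of the SAME run (`Σ_{T ∩ W} f ≤ η·Σ_T f`, the single-run lowered-threshold
suppression — hypothesis `hW`, NE7b/E2 species, not printed slot-wise), the candidates sum to `≤ η·Σ_T f`: the
hypothesis `hA`/`hB` of `exists_joint_common_threshold_suppressed` at one slot. [folklore] -/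
theorem sum_shells_le_of_window {ι : Type*} [DecidableEq ι] (T : Finset ι) {n : ℕ} (E : ℕ → Finset ι)
    (W : Finset ι) (hdisj : ∀ i < n, ∀ i' < n, i ≠ i' → Disjoint (E i) (E i')) (hsub : ∀ i < n, E i ⊆ W)
    {f : ι → ℝ} (hf : ∀ τ ∈ T, 0 ≤ f τ) {η : ℝ} (hW : ∑ τ ∈ T ∩ W, f τ ≤ η * ∑ τ ∈ T, f τ) :
    ∑ i ∈ range n, ∑ τ ∈ T ∩ E i, f τ ≤ η * ∑ τ ∈ T, f τ := by
  have h1 : ∑ i ∈ range n, ∑ τ ∈ T ∩ E i, f τ = ∑ i ∈ range n, ∑ τ ∈ (T ∩ W) ∩ E i, f τ := by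
    refine sum_congr rfl fun i hi => ?_
    have hE : T ∩ E i = (T ∩ W) ∩ E i := by
      ext τ
      simp only [mem_inter]
      constructor
      · rintro ⟨hT, hEi⟩
        exact ⟨⟨hT, hsub i (mem_range.mp hi) hEi⟩, hEi⟩
      · rintro ⟨⟨hT, _⟩, hEi⟩
        exact ⟨hT, hEi⟩
    rw [hE]
  rw [h1]
  exact (sum_disjoint_shells_le (T ∩ W) E hdisj fun τ hτ => hf τ (mem_inter.mp hτ).1).trans hW

/-- PER-SLOT SUPPRESSED DISJOINTNESS SUMS TO `ν·η`: if for every slot the weights of its `n` candidate shells sum to at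
most `η·Z`, the level's candidate totals sum to at most `(ν·η)·Z`, `ν` = number of slots
(`T4ShellMeasure.sum_candidates_le_card_mul` with `Z ↦ η·Z`). [folklore] -/
theorem sum_candidates_le_card_mul_smul {σ : Type*} (S : Finset σ) (n : ℕ) (f : σ → ℕ → ℝ) {η Z : ℝ}
    (hf : ∀ s ∈ S, ∑ i ∈ range n, f s i ≤ η * Z) :
    ∑ i ∈ range n, ∑ s ∈ S, f s i ≤ (S.card * η) * Z := by
  rw [mul_assoc]
  exact sum_candidates_le_card_mul S n f hf

/-- **THE SUPPRESSED JOINT TWO-RUN PIGEONHOLE** (product form of `T4ShellMeasure.exists_joint_common_threshold`, to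
which it specialises for `η ≡ 1`).  Slots `S l` per live level, candidate-weight functions `fA l s c, fB l s c ≥ 0` of
the WHOLE assignment `c`, and OWN-COORDINATE DISJOINTNESS INSIDE THE LOWERED-THRESHOLD EVENT: for every frozen
assignment the `n l` candidate weights of a slot along its own level sum to at most `η_l ×` the run's total weight
`ZA`, `ZB > 0` (`η_l` = each run's OWN single-run small factor of its slack window at level `l`;
`sum_shells_le_of_window`).  Then SOME assignment of the grid makes, in BOTH runs at once, the shell weight summed
over all live levels at most `(Σ_l 2ν_lη_l/n_l) ×` the total weight, `ν_l = #(S l)`.  No nesting of the two runs'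
large-field regions is involved. [folklore] -/
theorem exists_joint_common_threshold_suppressed {Λ σ : Type*} [DecidableEq Λ] [Fintype Λ] (n : Λ → ℕ)
    (hn : ∀ l, 0 < n l) (S : Λ → Finset σ) (η : Λ → ℝ) (fA fB : Λ → σ → (Λ → ℕ) → ℝ) {ZA ZB : ℝ}
    (hZA : 0 < ZA) (hZB : 0 < ZB)
    (hA0 : ∀ l, ∀ s ∈ S l, ∀ c, 0 ≤ fA l s c) (hB0 : ∀ l, ∀ s ∈ S l, ∀ c, 0 ≤ fB l s c)
    (hA : ∀ l, ∀ s ∈ S l, ∀ c ∈ candGrid n,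
      ∑ m ∈ range (n l), fA l s (Function.update c l m) ≤ η l * ZA)
    (hB : ∀ l, ∀ s ∈ S l, ∀ c ∈ candGrid n,
      ∑ m ∈ range (n l), fB l s (Function.update c l m) ≤ η l * ZB) :
    ∃ c ∈ candGrid n,
      ∑ l, ∑ s ∈ S l, fA l s c ≤ (∑ l, 2 * ((S l).card : ℝ) * η l / n l) * ZA ∧
      ∑ l, ∑ s ∈ S l, fB l s c ≤ (∑ l, 2 * ((S l).card : ℝ) * η l / n l) * ZB := by
  set g : Λ → (Λ → ℕ) → ℝ := fun l c => (∑ s ∈ S l, fA l s c) / ZA + (∑ s ∈ S l, fB l s c) / ZB with hg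
  have hfib : ∀ l ∈ (univ : Finset Λ), ∀ c ∈ candGrid n,
      ∑ c' ∈ (candGrid n).filter (fun c' => Function.update c' l 0 = Function.update c l 0), g l c'
        ≤ 2 * ((S l).card : ℝ) * η l := by
    intro l _ c hc
    rw [sum_filter_candGrid_update n l hc]
    have h1 : ∑ m ∈ range (n l), (∑ s ∈ S l, fA l s (Function.update c l m)) / ZA ≤ (S l).card * η l := by
      rw [← sum_div, div_le_iff₀ hZA]
      exact sum_candidates_le_card_mul_smul (S l) (n l) (fun s m => fA l s (Function.update c l m))
        fun s hs => hA l s hs c hc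
    have h2 : ∑ m ∈ range (n l), (∑ s ∈ S l, fB l s (Function.update c l m)) / ZB ≤ (S l).card * η l := by
      rw [← sum_div, div_le_iff₀ hZB]
      exact sum_candidates_le_card_mul_smul (S l) (n l) (fun s m => fB l s (Function.update c l m))
        fun s hs => hB l s hs c hc
    have e : (2 : ℝ) * ((S l).card : ℝ) * η l = (S l).card * η l + (S l).card * η l := by ring
    simp only [hg, sum_add_distrib]
    linarith
  obtain ⟨c, hc, hle⟩ := exists_joint_choice_of_fibres (candGrid n) (candGrid_nonempty hn) univ
    (fun l c => Function.update c l 0) g n (fun l => 2 * ((S l).card : ℝ) * η l) (fun l _ => hn l)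
    (fun l _ c hc => card_filter_candGrid_update n l hc) hfib
  have hAq : ∑ l, (∑ s ∈ S l, fA l s c) / ZA ≤ ∑ l, 2 * ((S l).card : ℝ) * η l / n l := by
    refine le_trans (sum_le_sum fun l _ => ?_) hle
    have h0 : 0 ≤ (∑ s ∈ S l, fB l s c) / ZB := div_nonneg (sum_nonneg fun s hs => hB0 l s hs c) hZB.le
    simp only [hg]
    linarith
  have hBq : ∑ l, (∑ s ∈ S l, fB l s c) / ZB ≤ ∑ l, 2 * ((S l).card : ℝ) * η l / n l := by
    refine le_trans (sum_le_sum fun l _ => ?_) hle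
    have h0 : 0 ≤ (∑ s ∈ S l, fA l s c) / ZA := div_nonneg (sum_nonneg fun s hs => hA0 l s hs c) hZA.le
    simp only [hg]
    linarith
  refine ⟨c, hc, ?_, ?_⟩
  · rw [← sum_div, div_le_iff₀ hZA] at hAq
    exact hAq
  · rw [← sum_div, div_le_iff₀ hZB] at hBq
    exact hBq

/-- SUPPRESSION BEATS SLOT ENTROPY (dictionary for the hypothesis `hent` of `levelFraction_le_of_suppressed`; a
smallness condition on `ḡ` of the printed TYPE — [Balaban1989LargeFieldII] p. 383, (1.79): small factors `exp(−p₀(g_j))`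
against counting factors — recorded as the hypothesis `hP`, not quoted as a fact): `ν ≤ v₀Λ^a` slots at age `a` and a
small factor `0 ≤ η ≤ e^{−P}` with `a·log Λ ≤ P` give `ν·η ≤ v₀`. [folklore] -/
theorem slotEntropy_le_of_suppression {ν η v₀ Λ P : ℝ} {a : ℕ} (hv₀ : 0 ≤ v₀) (hΛ : 0 < Λ) (hη0 : 0 ≤ η)
    (hν : ν ≤ v₀ * Λ ^ a) (hη : η ≤ Real.exp (-P)) (hP : (a : ℝ) * Real.log Λ ≤ P) : ν * η ≤ v₀ := by
  have hΛa : Λ ^ a ≤ Real.exp P := by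
    rw [← Real.exp_log (pow_pos hΛ a), Real.log_pow]
    exact Real.exp_le_exp.mpr hP
  have h1 : Λ ^ a * Real.exp (-P) ≤ 1 := by
    calc Λ ^ a * Real.exp (-P) ≤ Real.exp P * Real.exp (-P) :=
          mul_le_mul_of_nonneg_right hΛa (Real.exp_pos _).le
      _ = 1 := by rw [← Real.exp_add, add_neg_cancel, Real.exp_zero]
  calc ν * η ≤ (v₀ * Λ ^ a) * η := mul_le_mul_of_nonneg_right hν hη0
    _ ≤ (v₀ * Λ ^ a) * Real.exp (-P) := mul_le_mul_of_nonneg_left hη (by positivity)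
    _ = v₀ * (Λ ^ a * Real.exp (-P)) := by ring
    _ ≤ v₀ * 1 := mul_le_mul_of_nonneg_left h1 hv₀
    _ = v₀ := mul_one v₀

/-- THE SUPPRESSED LEVEL FRACTION (product form of `T4ShellMeasure.levelFraction_le_of_rate`): if suppression beats
slot entropy, `ν·η ≤ v₀` (`slotEntropy_le_of_suppression`), and `2/n ≤ D̄ρ` (candidate count,
`T4ShellMeasure.candidateCount_spec`), `ρ ≤ c₁x` (`x = ϑ^{K−a}`: the (F∞)-rate — NOT PRINTED), then
`2νη/n ≤ (v₀D̄c₁)·x` — the sibling's constant `ν̄D̄c₁`, `ν̄ = v₀Λ^{N₁}`, loses the window entropy `Λ^{N₁}`.  CONSTANTS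
ONLY: the `K`-decay is `x`'s. [folklore] -/
theorem levelFraction_le_of_suppressed {ν η n ρ v₀ Dbar c₁ x : ℝ} (hv₀ : 0 ≤ v₀) (hDbar : 0 ≤ Dbar)
    (hent : ν * η ≤ v₀) (hn : 0 < n) (hnρ : 2 / n ≤ Dbar * ρ) (hρ : ρ ≤ c₁ * x) :
    2 * ν * η / n ≤ (v₀ * Dbar * c₁) * x := by
  have h2n : 0 ≤ 2 / n := by positivity
  calc 2 * ν * η / n = (ν * η) * (2 / n) := by ring
    _ ≤ v₀ * (Dbar * ρ) := mul_le_mul hent hnρ h2n hv₀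
    _ ≤ v₀ * (Dbar * (c₁ * x)) := by gcongr
    _ = (v₀ * Dbar * c₁) * x := by ring

/-- **THE SUPPRESSED CHOICE FUNCTION** (product form of `T4ShellMeasure.exists_threshold_choice_function`, IDENTICAL
OUTPUT SHAPE — so `T4ShellMeasure.SlotLedger.of_realized` / `shellWeightBound_of_realized` consume it unchanged, after
the same flattening of the slots of all ages).  Per number of steps `K`: candidate counts `n K a ≥ 1`, slots `S K a` and
each run's own small factors `η K a` per age `a ∈ Fin (N₁ + 1)`, candidate weights with own-coordinate disjointness
INSIDE the lowered-threshold events (`≤ η K a ×` the totals `ZA K`, `ZB K > 0`), and suppressed level fractions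
`2νη/n ≤ M·ϑ^{K−a}` (`levelFraction_le_of_suppressed`, `M = v₀D̄c₁`).  Then ONE assignment `c⋆ K` per `K` makes both
runs' window-summed shell weights `≤ ((N₁ + 1)Mϑ^{−N₁})·ϑ^K ×` the totals. [folklore] -/
theorem exists_threshold_choice_function_suppressed {σ : Type*} (N₁ : ℕ) (n : ℕ → Fin (N₁ + 1) → ℕ)
    (hn : ∀ K a, 0 < n K a) (S : ℕ → Fin (N₁ + 1) → Finset σ) (η : ℕ → Fin (N₁ + 1) → ℝ)
    (fA fB : ℕ → Fin (N₁ + 1) → σ → (Fin (N₁ + 1) → ℕ) → ℝ) (ZA ZB : ℕ → ℝ)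
    (hZA : ∀ K, 0 < ZA K) (hZB : ∀ K, 0 < ZB K)
    (hA0 : ∀ K a, ∀ s ∈ S K a, ∀ c, 0 ≤ fA K a s c) (hB0 : ∀ K a, ∀ s ∈ S K a, ∀ c, 0 ≤ fB K a s c)
    (hA : ∀ K a, ∀ s ∈ S K a, ∀ c ∈ candGrid (n K),
      ∑ m ∈ range (n K a), fA K a s (Function.update c a m) ≤ η K a * ZA K)
    (hB : ∀ K a, ∀ s ∈ S K a, ∀ c ∈ candGrid (n K),
      ∑ m ∈ range (n K a), fB K a s (Function.update c a m) ≤ η K a * ZB K)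
    {M ϑ : ℝ} (hϑ0 : 0 < ϑ) (hϑ1 : ϑ ≤ 1) (hM : 0 ≤ M)
    (hlev : ∀ K a, 2 * ((S K a).card : ℝ) * η K a / n K a ≤ M * ϑ ^ (K - (a : ℕ))) :
    ∃ cstar : ℕ → (Fin (N₁ + 1) → ℕ), ∀ K, cstar K ∈ candGrid (n K) ∧
      ∑ a, ∑ s ∈ S K a, fA K a s (cstar K) ≤ ((((N₁ : ℝ) + 1) * M * ϑ⁻¹ ^ N₁) * ϑ ^ K) * ZA K ∧
      ∑ a, ∑ s ∈ S K a, fB K a s (cstar K) ≤ ((((N₁ : ℝ) + 1) * M * ϑ⁻¹ ^ N₁) * ϑ ^ K) * ZB K := by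
  have hK : ∀ K, ∃ c ∈ candGrid (n K),
      ∑ a, ∑ s ∈ S K a, fA K a s c ≤ ((((N₁ : ℝ) + 1) * M * ϑ⁻¹ ^ N₁) * ϑ ^ K) * ZA K ∧
      ∑ a, ∑ s ∈ S K a, fB K a s c ≤ ((((N₁ : ℝ) + 1) * M * ϑ⁻¹ ^ N₁) * ϑ ^ K) * ZB K := by
    intro K
    obtain ⟨c, hc, hAK, hBK⟩ := exists_joint_common_threshold_suppressed (n K) (hn K) (S K) (η K) (fA K)
      (fB K) (hZA K) (hZB K) (hA0 K) (hB0 K) (hA K) (hB K)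
    have hq : ∑ a, 2 * ((S K a).card : ℝ) * η K a / n K a ≤ (((N₁ : ℝ) + 1) * M * ϑ⁻¹ ^ N₁) * ϑ ^ K :=
      ageSum_le_geometric K N₁ (fun a => 2 * ((S K a).card : ℝ) * η K a / n K a) hϑ0 hϑ1 hM (hlev K)
    exact ⟨c, hc, hAK.trans (mul_le_mul_of_nonneg_right hq (hZA K).le),
      hBK.trans (mul_le_mul_of_nonneg_right hq (hZB K).le)⟩
  exact ⟨fun K => (hK K).choose, fun K => (hK K).choose_spec⟩

/-- Sanity (product form, non-degenerate): with `ν = 4v₀` slots of small factor `η = 1/4` at age `a = 2` and blocking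
factor `Λ = 2`, the entropy condition `2·log 2 ≤ P := log 4` holds with `e^{−P} = 1/4`, and
`slotEntropy_le_of_suppression` returns `ν·η ≤ v₀` with equality: the suppression exactly cancels the slot count
`Λ^a = 4`. [folklore] -/
example (v₀ : ℝ) (hv₀ : 0 ≤ v₀) : (v₀ * 4) * (1 / 4 : ℝ) ≤ v₀ := by
  have hP : ((2 : ℕ) : ℝ) * Real.log 2 ≤ Real.log 4 := by
    rw [show (4 : ℝ) = 2 ^ 2 by norm_num, Real.log_pow]
  have hη : (1 / 4 : ℝ) ≤ Real.exp (-Real.log 4) := by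
    rw [Real.exp_neg, Real.exp_log (by norm_num : (0 : ℝ) < 4)]
    norm_num
  have hν : v₀ * 4 ≤ v₀ * (2 : ℝ) ^ (2 : ℕ) := by norm_num
  exact slotEntropy_le_of_suppression hv₀ (by norm_num : (0 : ℝ) < 2) (by norm_num) hν hη hP

end ProductForm

/-! ## §7 (v1.2) The entropy margin IS the γ-clause: window entropy against the printed exponent profile

Dictionary (not kernel).  After the U5b node owner's design ruling (record `t4/T4-EST-U5bE2.md` v1.3 §5: design (η),
Lipschitz cut-offs, ADMITTED as a NON-PRINTED procedure — T4-DAG v17 §8 Q25) the weight slot of NE7 under (η) is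
`T4LipschitzCutoff.shellWeightBound_of_lipProfile` with band weight `Wsh K = Σ_{a ≤ N} n_a · lipWeight L_χ S ρ a K`;
its inputs are the single-run SIBLING SUPPRESSION `S(a)` (NE7b / E2 species, NOT PRINTED slot-wise), the two-run width
`ρ` of (F∞) (node U4′, NOT PRINTED), the cube count (PRINTED SHAPE), the Lipschitz constants `L_χ(a)` (the price of (η),
`T4LipschitzCutoff` §4–§5: `2^{M+O(1)}/β²` with `M` a ladder length inside the live window — booked `2^{N+O(1)}/β²` on
the U5b owner's sheet, `t4/T4-EST-U5bE2.md` v1.3 §5 — window-only numbers, `K`-free; typed below as `L_χ(a) ≤ L̄Γ^N`),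
and ONE positivity margin: window entropy `Λ^a L_χ(a)` against the suppression exponent — the hypothesis `hP` of §6 `slotEntropy_le_of_suppression`, the margin
named in `T4LipschitzCutoff.tsum_weight_le_of_printedShapes`, and, per `K`, what the field `lt_one : W K + Wsh K < 1` of
`T4MatchingAssembly.HybridNE7` asks of the shell slot.  THIS SECTION DERIVES THAT MARGIN from the typed printed exponent
relations, leaving a closed-form smallness condition on the infrared coupling `ḡ` with an explicit threshold:
* the live window is capped by the printed waiting time: [Balaban1989LargeFieldI] p. 177 condition (ii) «in the preceding
  N renormalization steps no new large field regions were created inside this component, …» and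
  [Balaban1989LargeFieldII] p. 361 «We have assumed here that N ≦ R_k.» — typed as the READING `N ≤ (1 + F)·R(ḡ)`
  (hypothesis `hN`, slack `F ≥ 0`; the identification of the two-run bookkeeping's live window (W1) with print's `N` is
  the cell's reading `t4/T4-XREAD-U5c.md`, not a quotation);
* `R(ḡ) ≤ L·(log ḡ⁻²)^r` is the typed (2.5) (`B14.IsRj`, `B14FlowStep.isRj_le_mul_logpow`), and the small-field exponent
  is `p₀(ḡ) = A₀(log ḡ⁻²)^{p₀}` (`p0Profile`) with `p₀ ≧ 5r` printed ([Balaban1988Convergent] p. 246, quoted in the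
  header) — so the window entropy `N·(log(ΛΓ) + 1) + E` is a polynomial of degree `r` in `log ḡ⁻²` against degree `p₀`:
  `margin_of_gammaClause` (the γ-clause shape is literally that of `T4PersistentHistoryCount.credit_dominates_window`,
  whose `gammaClause_of_threshold` / `exists_threshold` give the explicit threshold `x₀ = max 1 (L(1+β₀)((1+F)κ₁+E)/(cA₀))`
  beyond which it holds — ONE threshold on `log ḡ⁻²` serves the old-slot survival condition there and the shell margin
  here);
* along a run the exponent at the birth scale of an age-`a` slot is at least the infrared one up to `(1+β₀)` by the first
  member of the typed (2.7) (`T4ScalePairing.p0Profile_ge_infrared`): `margin_at_birthScales` — which is why the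
  suppression hypothesis of the package is stated with the infrared-transferred exponent `c·p₀(ḡ)/(1+β₀)`, uniformly in
  the age and in `K`.
CONSEQUENCE (`lipWeightSum_le_of_margin`, `lipWeightSum_le_of_gammaClause`, `lt_one_of_gammaClause`): under the cube
count, `L_χ(a) ≤ L̄Γ^N`, `S(a) ≤ exp(−c·p₀(ḡ)/(1+β₀))`, a UNIFORM bound `ρ_j ≤ ρ̄` on the two-run width (only the sup
is used here — summability of `ρ` is what `ShellWeightBound.summable` consumes, §3 of `T4LipschitzCutoff`), and the
γ-clause, the (η) band weight satisfies `Wsh K ≤ ε` for EVERY `K`, hence `W K + Wsh K < 1` as soon as NE7b's `W K ≤ W̄`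
with `W̄ + ε < 1`.  So the margin is NOT an independent missing inequality of the weight route: it is the same species
as every «if g_k is small enough» of the series (p. 361 loc. cit.), made exact.  ANSWER to the sibling record
`t4/T4-EST-NE7c-P2.md` Q-η-1 («is 2^N polylog in g_k⁻¹?»): not as such — `2^N ≤ exp((1+F)L·log 2·(log ḡ⁻²)^r)` is
quasi-polynomial in `ḡ⁻¹` — but the question is moot: what the margin compares is the DEGREE `r` of the window against
the degree `p₀ > r` of the exponent (`margin_of_gammaClause`).  PRINTED PRECEDENT WITH PROOF of exactly this comparison
(outside the audited series, one run, φ⁴₃): J. Dimock, *The Renormalization Group According to Balaban III.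
Convergence*, Ann. Henri Poincaré (2014), doi:10.1007/s00023-013-0303-3 = arXiv:1304.0705, proof of Lemma 15 (the cell's
store text `paper-arxiv-1304.0705` p0018 L88, read by this seat): «We can assume 3r+2 < 2p₀. Then for −log λ and hence
−log λ_j sufficiently large, the first exponential is bounded by one.» — window/volume entropy of degree `3r + 2` in
`−log λ` against the exponent of degree `2p₀` (located by this lineage's record v1.2 §6(6f); quoted as precedent for the
SHAPE of the comparison, not used as a hypothesis).  HONEST LABEL: nothing here touches the `K`-decay — that is
`ρ`'s ((F∞), node U4′) — nor E2; and under (η) the margin is NOT existence-critical: `Σ_K Wsh_K ≤ C₀·Σ_j ρ_j` is finite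
for ANY finite `C₀` (`T4LipschitzCutoff.tsum_weight_le_of_printedShapes`) and `W K + Wsh K < 1` holds in the tail for
free once both weights are summable (`T4MatchingClosure.eventually_budget_lt_one`, the closure's `K₀` shift).  What the
section buys is ḡ-UNIFORM smallness of the shell slot at EVERY `K` — no head shift (`K₀ = 0`), constants explicit and
bounded as `ḡ → 0` below ONE threshold although the (η) price `2^{N(ḡ)}` and the window `N(ḡ) ~ R(ḡ)` grow — i.e. the
margin leaves the list of independent inputs and the weight route's constants do not degrade with the coupling.
(v1.3) PRINT-SHAPED FORM.  [Balaban1989LargeFieldI] p. 198 (after (1.94)) prints the one-run waiting window as a POWER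
of `log g_k⁻²`: «we assume that N ≦ O(1)(log g_k^{−2})^ν … with a positive integer ν satisfying (1/2)ν ≦ p₀ − p₁ − 1»;
`margin_of_windowPow` takes the READING `N ≤ D·(log ḡ⁻²)^ν` (`ν ≤ p₀`) with the γ-clause at degree `p₀ − ν` —
`margin_of_gammaClause` is its instance `D = (1+F)L`, `ν = r`.
[folklore arithmetic] -/

section Margin

open T4ShellCount (C0 CubeCount)
open T4LipschitzCutoff (lipWeight C0_le_of_cubeCount')
open T4ScalePairing (p0Profile_ge_infrared)

/-- The band-cut gain of design (η) under a UNIFORM bound on the two-run width: `lipWeight L_χ S ρ a K ≤ L_χ(a)S(a)ρ̄`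
for every `K` (on the band `ρ(K − a) ≤ ρ̄`; off it the gain is `0`). [folklore] -/
theorem lipWeight_le_of_sup {Lχ S ρ : ℕ → ℝ} {ρbar : ℝ} {N a : ℕ} (hL : ∀ a ≤ N, 0 ≤ Lχ a) (hS : ∀ a ≤ N, 0 ≤ S a)
    (hρ0 : ∀ j, 0 ≤ ρ j) (hρ : ∀ j, ρ j ≤ ρbar) (ha : a ≤ N) (K : ℕ) :
    lipWeight Lχ S ρ a K ≤ Lχ a * S a * ρbar := by
  unfold lipWeight
  split_ifs
  · exact mul_le_mul_of_nonneg_left (hρ _) (mul_nonneg (hL a ha) (hS a ha))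
  · exact mul_nonneg (mul_nonneg (hL a ha) (hS a ha)) ((hρ0 0).trans (hρ 0))

/-- PER `K`: the (η) band weight is at most the count × suppression number `C₀(n, L_χ·S)` times the uniform width bound
`ρ̄` — the currency of `lt_one`, cf. §3 `windowMass_le_uniform`. [folklore] -/
theorem lipWeightSum_le_C0_mul {N : ℕ} {n : ℕ → ℕ} {Lχ S ρ : ℕ → ℝ} {ρbar : ℝ} (hL : ∀ a ≤ N, 0 ≤ Lχ a)
    (hS : ∀ a ≤ N, 0 ≤ S a) (hρ0 : ∀ j, 0 ≤ ρ j) (hρ : ∀ j, ρ j ≤ ρbar) (K : ℕ) :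
    ∑ a ∈ range (N + 1), (n a : ℝ) * lipWeight Lχ S ρ a K
      ≤ C0 N (fun a => (n a : ℝ)) (fun a => Lχ a * S a) * ρbar := by
  unfold C0
  rw [sum_mul]
  refine sum_le_sum fun a ha => ?_
  have ha' := Finset.mem_range_succ_iff.1 ha
  calc (n a : ℝ) * lipWeight Lχ S ρ a K ≤ (n a : ℝ) * (Lχ a * S a * ρbar) :=
        mul_le_mul_of_nonneg_left (lipWeight_le_of_sup hL hS hρ0 hρ ha' K) (Nat.cast_nonneg _)
    _ = (n a : ℝ) * (Lχ a * S a) * ρbar := by ring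

/-- WINDOW ENTROPY IN EXPONENTIAL FORM: `(N + 1)Θ^N ≤ exp(N(log Θ + 1))` for `Θ ≥ 1`. [folklore] -/
theorem succ_mul_pow_le_exp {Θ : ℝ} (hΘ : 1 ≤ Θ) (N : ℕ) :
    ((N : ℝ) + 1) * Θ ^ N ≤ Real.exp ((N : ℝ) * (Real.log Θ + 1)) := by
  have hN1 : (N : ℝ) + 1 ≤ Real.exp N := by
    have := Real.add_one_le_exp (N : ℝ)
    linarith
  have hΘN : Θ ^ N = Real.exp ((N : ℝ) * Real.log Θ) := by
    rw [← Real.exp_log (pow_pos (by linarith) N), Real.log_pow]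
  calc ((N : ℝ) + 1) * Θ ^ N ≤ Real.exp N * Real.exp ((N : ℝ) * Real.log Θ) := by
        rw [hΘN]
        exact mul_le_mul_of_nonneg_right hN1 (Real.exp_pos _).le
    _ = Real.exp ((N : ℝ) * (Real.log Θ + 1)) := by
        rw [← Real.exp_add]
        congr 1
        ring

/-- THE COUNT × SUPPRESSION NUMBER ON THE WINDOW, EXPONENTIAL FORM: cube count `n_a ≤ VΛ^a` (PRINTED SHAPE), Lipschitz
constants `L_χ(a) ≤ L̄Γ^N` UNIFORMLY ON THE WINDOW (the price of (η), NOT PRINTED: `2^{N+O(1)}/β²` by the U5b owner's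
sheet `t4/T4-EST-U5bE2.md` v1.3 §5 — `Γ = 2`, `L̄ = O(1)β^{−2}`; an age-dependent `L̄Γ^a` is covered since `Γ^a ≤ Γ^N`),
suppression `S(a) ≤ e^{−P}` uniformly on the window (NE7b / E2 species with the infrared-transferred exponent, NOT
PRINTED slot-wise), `Λ, Γ ≥ 1` ⇒ `C₀(n, L_χ·S) ≤ V·L̄·exp(N(log(ΛΓ) + 1) − P)`. [folklore] -/
theorem C0_le_window_exp {N : ℕ} {n : ℕ → ℕ} {V Λ Γ Lbar P : ℝ} {Lχ S : ℕ → ℝ}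
    (hc : CubeCount N n V Λ) (hΛ : 1 ≤ Λ) (hΓ : 1 ≤ Γ) (hLbar : 0 ≤ Lbar)
    (hL : ∀ a ≤ N, 0 ≤ Lχ a ∧ Lχ a ≤ Lbar * Γ ^ N) (hS : ∀ a ≤ N, 0 ≤ S a ∧ S a ≤ Real.exp (-P)) :
    C0 N (fun a => (n a : ℝ)) (fun a => Lχ a * S a)
      ≤ V * Lbar * Real.exp ((N : ℝ) * (Real.log (Λ * Γ) + 1) - P) := by
  have hV : 0 ≤ V := by
    have := hc 0 (Nat.zero_le _)
    rw [pow_zero, mul_one] at this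
    exact (Nat.cast_nonneg _).trans this
  have hΛ0 : 0 ≤ Λ := by linarith
  have h1 : C0 N (fun a => (n a : ℝ)) (fun a => Lχ a * S a) ≤ V * ∑ a ∈ range (N + 1), Λ ^ a * (Lχ a * S a) :=
    C0_le_of_cubeCount' (s := fun a => Lχ a * S a) hc fun a ha => mul_nonneg (hL a ha).1 (hS a ha).1
  have h2 : ∑ a ∈ range (N + 1), Λ ^ a * (Lχ a * S a)
      ≤ ∑ _a ∈ range (N + 1), Λ ^ N * ((Lbar * Γ ^ N) * Real.exp (-P)) := by
    refine sum_le_sum fun a ha => ?_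
    have ha' := Finset.mem_range_succ_iff.1 ha
    exact mul_le_mul (pow_le_pow_right₀ hΛ ha')
      (mul_le_mul (hL a ha').2 (hS a ha').2 (hS a ha').1 (by positivity))
      (mul_nonneg (hL a ha').1 (hS a ha').1) (pow_nonneg hΛ0 _)
  rw [sum_const, card_range, nsmul_eq_mul] at h2
  have h3 := succ_mul_pow_le_exp (one_le_mul_of_one_le_of_one_le hΛ hΓ) N
  have hkey : ∑ a ∈ range (N + 1), Λ ^ a * (Lχ a * S a)
      ≤ Real.exp ((N : ℝ) * (Real.log (Λ * Γ) + 1)) * (Lbar * Real.exp (-P)) := by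
    calc ∑ a ∈ range (N + 1), Λ ^ a * (Lχ a * S a)
        ≤ ((N + 1 : ℕ) : ℝ) * (Λ ^ N * ((Lbar * Γ ^ N) * Real.exp (-P))) := h2
      _ = (((N : ℝ) + 1) * (Λ * Γ) ^ N) * (Lbar * Real.exp (-P)) := by push_cast; rw [mul_pow]; ring
      _ ≤ Real.exp ((N : ℝ) * (Real.log (Λ * Γ) + 1)) * (Lbar * Real.exp (-P)) :=
          mul_le_mul_of_nonneg_right h3 (by positivity)
  calc C0 N (fun a => (n a : ℝ)) (fun a => Lχ a * S a) ≤ V * ∑ a ∈ range (N + 1), Λ ^ a * (Lχ a * S a) := h1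
    _ ≤ V * (Real.exp ((N : ℝ) * (Real.log (Λ * Γ) + 1)) * (Lbar * Real.exp (-P))) :=
        mul_le_mul_of_nonneg_left hkey hV
    _ = V * Lbar * Real.exp ((N : ℝ) * (Real.log (Λ * Γ) + 1) - P) := by
        rw [sub_eq_add_neg, Real.exp_add]
        ring

/-- **THE (η) BAND WEIGHT UNDER THE MARGIN, EVERY `K`.**  With `V·L̄·ρ̄ ≤ e^{E₀}` and the margin
`E₀ + log ε⁻¹ + N(log(ΛΓ) + 1) ≤ P` (window entropy + target against the uniform suppression exponent):
`Σ_{a ≤ N} n_a · lipWeight L_χ S ρ a K ≤ ε` for every `K`. [folklore] -/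
theorem lipWeightSum_le_of_margin {N : ℕ} {n : ℕ → ℕ} {V Λ Γ Lbar P ρbar E₀ ε : ℝ} {Lχ S ρ : ℕ → ℝ}
    (hc : CubeCount N n V Λ) (hΛ : 1 ≤ Λ) (hΓ : 1 ≤ Γ) (hLbar : 0 ≤ Lbar)
    (hL : ∀ a ≤ N, 0 ≤ Lχ a ∧ Lχ a ≤ Lbar * Γ ^ N) (hS : ∀ a ≤ N, 0 ≤ S a ∧ S a ≤ Real.exp (-P))
    (hρ0 : ∀ j, 0 ≤ ρ j) (hρ : ∀ j, ρ j ≤ ρbar) (hVL : V * Lbar * ρbar ≤ Real.exp E₀) (hε : 0 < ε)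
    (hmargin : E₀ + Real.log ε⁻¹ + (N : ℝ) * (Real.log (Λ * Γ) + 1) ≤ P) (K : ℕ) :
    ∑ a ∈ range (N + 1), (n a : ℝ) * lipWeight Lχ S ρ a K ≤ ε := by
  have hρbar : 0 ≤ ρbar := (hρ0 0).trans (hρ 0)
  have h1 := lipWeightSum_le_C0_mul (n := n) (fun a ha => (hL a ha).1) (fun a ha => (hS a ha).1) hρ0 hρ K
  have h2 := C0_le_window_exp hc hΛ hΓ hLbar hL hS
  have hexp : Real.exp E₀ * Real.exp ((N : ℝ) * (Real.log (Λ * Γ) + 1) - P) ≤ ε := by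
    rw [← Real.exp_add]
    calc Real.exp (E₀ + ((N : ℝ) * (Real.log (Λ * Γ) + 1) - P)) ≤ Real.exp (-Real.log ε⁻¹) :=
          Real.exp_le_exp.2 (by linarith)
      _ = ε := by rw [Real.log_inv, neg_neg, Real.exp_log hε]
  calc ∑ a ∈ range (N + 1), (n a : ℝ) * lipWeight Lχ S ρ a K
      ≤ C0 N (fun a => (n a : ℝ)) (fun a => Lχ a * S a) * ρbar := h1
    _ ≤ (V * Lbar * Real.exp ((N : ℝ) * (Real.log (Λ * Γ) + 1) - P)) * ρbar :=
        mul_le_mul_of_nonneg_right h2 hρbar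
    _ = (V * Lbar * ρbar) * Real.exp ((N : ℝ) * (Real.log (Λ * Γ) + 1) - P) := by ring
    _ ≤ Real.exp E₀ * Real.exp ((N : ℝ) * (Real.log (Λ * Γ) + 1) - P) :=
        mul_le_mul_of_nonneg_right hVL (Real.exp_pos _).le
    _ ≤ ε := hexp

/-- **THE MARGIN IS THE γ-CLAUSE** (final-scale form; kernel: the typed (2.5) only).  Window cap `N ≤ (1 + F)·R(ḡ)`
(READING of [Balaban1989LargeFieldI] p. 177 (ii) / [Balaban1989LargeFieldII] p. 361 «We have assumed here that N ≦ R_k.»,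
slack `F ≥ 0`), `R(ḡ)` tied to `ḡ` by (2.5) (`B14.IsRj`), `1 ≤ log ḡ⁻²`, `r ≤ p₀` (print: `p₀ ≧ 5r`), entropy rate
`κ₁ ≥ 0` per unit of window and fixed entropy `E ≥ 0`; under the γ-CLAUSE on the infrared coupling
`L(1+β₀)((1+F)κ₁ + E) ≤ c·A₀·(log ḡ⁻²)^{p₀−r}` — the shape of `T4PersistentHistoryCount.credit_dominates_window`, holding
beyond the explicit threshold of `T4PersistentHistoryCount.gammaClause_of_threshold` — one has
`(1+β₀)(κ₁N + E) ≤ c·p₀(ḡ)`.  Degree `r` against degree `p₀`: the answer to Q-η-1 of `t4/T4-EST-NE7c-P2.md`. [folklore] -/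
theorem margin_of_gammaClause {gbar : ℝ} {R : ℕ} {β₀ A₀ c F E κ₁ Nw : ℝ} {L p₀ r : ℕ}
    (hR : B14.IsRj L r gbar R) (hrp : r ≤ p₀) (hL : 1 ≤ L) (hβ : 0 ≤ β₀) (hF : 0 ≤ F) (hE : 0 ≤ E) (hκ : 0 ≤ κ₁)
    (hx1 : 1 ≤ Real.log (gbar ^ 2)⁻¹) (hN : Nw ≤ (1 + F) * R)
    (hγ : (L : ℝ) * (1 + β₀) * ((1 + F) * κ₁ + E) ≤ c * A₀ * (Real.log (gbar ^ 2)⁻¹) ^ (p₀ - r)) :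
    (1 + β₀) * (κ₁ * Nw + E) ≤ c * p0Profile A₀ p₀ gbar := by
  set x : ℝ := Real.log (gbar ^ 2)⁻¹ with hx
  have hx0 : 0 ≤ x := by linarith
  have hR1 : (1 : ℝ) ≤ R := by
    -- `R = L^s ≥ 1` (cf. `T4PersistentHistoryCount.one_le_cast_of_isRj`)
    obtain ⟨s, hRs, -, -⟩ := hR
    subst hRs
    exact_mod_cast one_le_pow₀ (M₀ := ℕ) hL
  have hRx : (R : ℝ) ≤ L * x ^ r := B14FlowStep.isRj_le_mul_logpow hL hR (one_le_pow₀ hx1)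
  have hsum : κ₁ * Nw + E ≤ ((1 + F) * κ₁ + E) * R := by
    have h1 : κ₁ * Nw ≤ κ₁ * ((1 + F) * R) := mul_le_mul_of_nonneg_left hN hκ
    have h2 : E ≤ E * R := by nlinarith
    nlinarith
  have hFκ : 0 ≤ (1 + F) * κ₁ + E := by positivity
  have hprof : p0Profile A₀ p₀ gbar = A₀ * x ^ p₀ := rfl
  have hsplit : x ^ p₀ = x ^ (p₀ - r) * x ^ r := by rw [← pow_add, Nat.sub_add_cancel hrp]
  calc (1 + β₀) * (κ₁ * Nw + E) ≤ (1 + β₀) * (((1 + F) * κ₁ + E) * R) :=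
        mul_le_mul_of_nonneg_left hsum (by linarith)
    _ ≤ (1 + β₀) * (((1 + F) * κ₁ + E) * (L * x ^ r)) :=
        mul_le_mul_of_nonneg_left (mul_le_mul_of_nonneg_left hRx hFκ) (by linarith)
    _ = ((L : ℝ) * (1 + β₀) * ((1 + F) * κ₁ + E)) * x ^ r := by ring
    _ ≤ (c * A₀ * x ^ (p₀ - r)) * x ^ r := mul_le_mul_of_nonneg_right hγ (pow_nonneg hx0 _)
    _ = c * p0Profile A₀ p₀ gbar := by rw [hprof, hsplit]; ring

/-- **ALONG THE RUN** (kernel: + the first member of the typed (2.7)).  For a run `g 0, …, g K` with `g K = ḡ` satisfying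
`B14.FlowIneq27 g β′ β₀ p₀ K`, the exponent at EVERY scale `s ≤ K` — in particular at the birth scale `K − a` of an
age-`a` slot — dominates the window entropy WITHOUT the factor `(1+β₀)`: `κ₁N + E ≤ c·p₀(g_s)`
(`T4ScalePairing.p0Profile_ge_infrared`).  This is why the package below states the suppression hypothesis with the
infrared-transferred exponent `c·p₀(ḡ)/(1+β₀)`, uniformly in the age and in `K`. [folklore] -/
theorem margin_at_birthScales {g : ℕ → ℝ} {R : ℕ} {β' β₀ A₀ c F E κ₁ Nw : ℝ} {L p₀ r K : ℕ}
    (h27 : B14.FlowIneq27 g β' β₀ p₀ K) (hR : B14.IsRj L r (g K) R) (hrp : r ≤ p₀) (hL : 1 ≤ L) (hβ : 0 ≤ β₀)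
    (hA : 0 ≤ A₀) (hc : 0 ≤ c) (hF : 0 ≤ F) (hE : 0 ≤ E) (hκ : 0 ≤ κ₁) (hx1 : 1 ≤ Real.log ((g K) ^ 2)⁻¹)
    (hN : Nw ≤ (1 + F) * R)
    (hγ : (L : ℝ) * (1 + β₀) * ((1 + F) * κ₁ + E) ≤ c * A₀ * (Real.log ((g K) ^ 2)⁻¹) ^ (p₀ - r)) :
    ∀ s, s ≤ K → κ₁ * Nw + E ≤ c * p0Profile A₀ p₀ (g s) := by
  intro s hs
  have hK := margin_of_gammaClause hR hrp hL hβ hF hE hκ hx1 hN hγ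
  have hir := p0Profile_ge_infrared h27 hβ hA (by linarith) s hs
  have h1β : 0 < 1 + β₀ := by linarith
  -- (1+β₀)(κ₁N + E) ≤ c p₀(g K) ≤ c (1+β₀) p₀(g s)
  have : (1 + β₀) * (κ₁ * Nw + E) ≤ (1 + β₀) * (c * p0Profile A₀ p₀ (g s)) := by
    calc (1 + β₀) * (κ₁ * Nw + E) ≤ c * p0Profile A₀ p₀ (g K) := hK
      _ ≤ c * ((1 + β₀) * p0Profile A₀ p₀ (g s)) := mul_le_mul_of_nonneg_left hir hc
      _ = (1 + β₀) * (c * p0Profile A₀ p₀ (g s)) := by ring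
  exact le_of_mul_le_mul_left this h1β

/-- **THE PACKAGE: PRINTED EXPONENT RELATIONS + γ-CLAUSE ⇒ THE (η) BAND WEIGHT IS `≤ ε` AT EVERY `K`.**  Inputs: cube
count (PRINTED SHAPE); `L_χ(a) ≤ L̄Γ^N` ((η)'s price `2^{N+O(1)}/β²`, NOT PRINTED); uniform two-run width `0 ≤ ρ_j ≤ ρ̄` ((F∞), node U4′,
NOT PRINTED — only the sup is used); sibling suppression with the infrared-transferred exponent
`0 ≤ S(a) ≤ exp(−c·p₀(ḡ)/(1+β₀))` (NE7b / E2 species, NOT PRINTED slot-wise; the transfer is `margin_at_birthScales`);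
`V·L̄·ρ̄ ≤ e^{E₀}`, target `0 < ε` with `0 ≤ E₀ + log ε⁻¹`; the window cap READING `N ≤ (1 + F)·R(ḡ)` with (2.5); and the
γ-clause at rate `κ₁ = log(ΛΓ) + 1` and fixed entropy `E = E₀ + log ε⁻¹`.  Output: `Σ_{a ≤ N} n_a·lipWeight L_χ S ρ a K ≤ ε`
for every `K` — uniformly, with the threshold depending on `log ḡ⁻²` only. [folklore] -/
theorem lipWeightSum_le_of_gammaClause {N : ℕ} {n : ℕ → ℕ} {V Λ Γ Lbar ρbar E₀ ε : ℝ} {Lχ S ρ : ℕ → ℝ}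
    {gbar β₀ A₀ c F : ℝ} {R L p₀ r : ℕ}
    (hc : CubeCount N n V Λ) (hΛ : 1 ≤ Λ) (hΓ : 1 ≤ Γ) (hLbar : 0 ≤ Lbar)
    (hL : ∀ a ≤ N, 0 ≤ Lχ a ∧ Lχ a ≤ Lbar * Γ ^ N)
    (hS : ∀ a ≤ N, 0 ≤ S a ∧ S a ≤ Real.exp (-(c * p0Profile A₀ p₀ gbar / (1 + β₀))))
    (hρ0 : ∀ j, 0 ≤ ρ j) (hρ : ∀ j, ρ j ≤ ρbar) (hVL : V * Lbar * ρbar ≤ Real.exp E₀) (hε : 0 < ε)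
    (hE : 0 ≤ E₀ + Real.log ε⁻¹)
    (hR : B14.IsRj L r gbar R) (hrp : r ≤ p₀) (hL1 : 1 ≤ L) (hβ : 0 ≤ β₀) (hF : 0 ≤ F)
    (hx1 : 1 ≤ Real.log (gbar ^ 2)⁻¹) (hN : (N : ℝ) ≤ (1 + F) * R)
    (hγ : (L : ℝ) * (1 + β₀) * ((1 + F) * (Real.log (Λ * Γ) + 1) + (E₀ + Real.log ε⁻¹))
      ≤ c * A₀ * (Real.log (gbar ^ 2)⁻¹) ^ (p₀ - r)) (K : ℕ) :
    ∑ a ∈ range (N + 1), (n a : ℝ) * lipWeight Lχ S ρ a K ≤ ε := by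
  have hκ : 0 ≤ Real.log (Λ * Γ) + 1 := by
    have : 0 ≤ Real.log (Λ * Γ) := Real.log_nonneg (one_le_mul_of_one_le_of_one_le hΛ hΓ)
    linarith
  have hm := margin_of_gammaClause hR hrp hL1 hβ hF hE hκ hx1 hN hγ
  have h1β : 0 < 1 + β₀ := by linarith
  have hmargin : E₀ + Real.log ε⁻¹ + (N : ℝ) * (Real.log (Λ * Γ) + 1)
      ≤ c * p0Profile A₀ p₀ gbar / (1 + β₀) := by
    rw [le_div_iff₀ h1β]
    calc (E₀ + Real.log ε⁻¹ + (N : ℝ) * (Real.log (Λ * Γ) + 1)) * (1 + β₀)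
        = (1 + β₀) * ((Real.log (Λ * Γ) + 1) * (N : ℝ) + (E₀ + Real.log ε⁻¹)) := by ring
      _ ≤ c * p0Profile A₀ p₀ gbar := hm
  exact lipWeightSum_le_of_margin hc hΛ hΓ hLbar hL hS hρ0 hρ hVL hε hmargin K

/-- **THE `lt_one` FIELD OF `T4MatchingAssembly.HybridNE7` UNDER (η).**  If NE7b's bad-class weights satisfy
`W K ≤ W̄` and the shell target `ε` is chosen with `W̄ + ε < 1`, then `W K + Wsh K < 1` at every `K` for the (η) band
weight `Wsh` under the hypotheses of `lipWeightSum_le_of_gammaClause`. [folklore] -/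
theorem lt_one_of_gammaClause {N : ℕ} {n : ℕ → ℕ} {V Λ Γ Lbar ρbar E₀ ε Wbar : ℝ} {Lχ S ρ W : ℕ → ℝ}
    {gbar β₀ A₀ c F : ℝ} {R L p₀ r : ℕ}
    (hc : CubeCount N n V Λ) (hΛ : 1 ≤ Λ) (hΓ : 1 ≤ Γ) (hLbar : 0 ≤ Lbar)
    (hL : ∀ a ≤ N, 0 ≤ Lχ a ∧ Lχ a ≤ Lbar * Γ ^ N)
    (hS : ∀ a ≤ N, 0 ≤ S a ∧ S a ≤ Real.exp (-(c * p0Profile A₀ p₀ gbar / (1 + β₀))))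
    (hρ0 : ∀ j, 0 ≤ ρ j) (hρ : ∀ j, ρ j ≤ ρbar) (hVL : V * Lbar * ρbar ≤ Real.exp E₀) (hε : 0 < ε)
    (hE : 0 ≤ E₀ + Real.log ε⁻¹)
    (hR : B14.IsRj L r gbar R) (hrp : r ≤ p₀) (hL1 : 1 ≤ L) (hβ : 0 ≤ β₀) (hF : 0 ≤ F)
    (hx1 : 1 ≤ Real.log (gbar ^ 2)⁻¹) (hN : (N : ℝ) ≤ (1 + F) * R)
    (hγ : (L : ℝ) * (1 + β₀) * ((1 + F) * (Real.log (Λ * Γ) + 1) + (E₀ + Real.log ε⁻¹))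
      ≤ c * A₀ * (Real.log (gbar ^ 2)⁻¹) ^ (p₀ - r))
    (hW : ∀ K, W K ≤ Wbar) (hWε : Wbar + ε < 1) (K : ℕ) :
    W K + ∑ a ∈ range (N + 1), (n a : ℝ) * lipWeight Lχ S ρ a K < 1 := by
  have := lipWeightSum_le_of_gammaClause hc hΛ hΓ hLbar hL hS hρ0 hρ hVL hε hE hR hrp hL1 hβ hF hx1 hN hγ K
  linarith [hW K]

/-- Sanity (the hypotheses of `margin_of_gammaClause` are inhabited non-degenerately): `ḡ = e^{−1}` has
`log ḡ⁻² = 2`; with `L = 2`, `r = 1` the (2.5)-window is `R = 2 = L¹` (`2^1 ≥ 2^1`, minimal); with `p₀ = 5` (print: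
`p₀ ≧ 5r`), `β₀ = F = 0`, `κ₁ = E = c = A₀ = 1` the γ-clause reads `2·1·2 = 4 ≤ 2^4`, and the theorem returns the margin
`(1 + 0)(1·2 + 1) ≤ 1·p₀(ḡ) = 2^5` for the full window `N = 2 = (1 + 0)·R`. [folklore] -/
example : (1 + (0 : ℝ)) * (1 * 2 + 1) ≤ 1 * p0Profile 1 5 (Real.exp (-1)) := by
  have hx : Real.log ((Real.exp (-1)) ^ 2)⁻¹ = 2 := by
    rw [← Real.exp_nat_mul, ← Real.exp_neg, Real.log_exp]
    norm_num
  have hR : B14.IsRj 2 1 (Real.exp (-1)) 2 := by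
    refine ⟨1, by norm_num, by rw [hx]; norm_num, fun s' hs' => ?_⟩
    rcases Nat.eq_zero_or_pos s' with h | h
    · subst h
      rw [hx] at hs'
      norm_num at hs'
    · exact h
  exact margin_of_gammaClause (F := 0) hR (by norm_num) (by norm_num) le_rfl le_rfl zero_le_one zero_le_one
    (by rw [hx]; norm_num) (by norm_num) (by rw [hx]; norm_num)

/-- **THE MARGIN FROM THE PRINTED WINDOW RESTRICTION (1.94)** (print-shaped form of `margin_of_gammaClause`).
[Balaban1989LargeFieldI] p. 198 [render p024], after (1.94): «The last inequality holds under two restrictions on N.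
At first, we assume that N ≦ O(1)(log g_k^{−2})^ν ≦ O(1)(1 + β₀)(log g_h^{−2})^ν with a positive integer ν satisfying
(1/2)ν ≦ p₀ − p₁ − 1. The second is that N has to be sufficiently large, so that the constant in the second term above
can be bounded by (1/2)α. These two conditions can be satisfied by N to the positive power of log g_k^{−2}.» — the ONE-RUN
waiting window is printed as a POWER `ν` of `log g_k⁻²`.  Typed READING for the two-run live window (as for `hN` above,
the identification is the cell's, `t4/T4-XREAD-U5c.md`): `N ≤ D·(log ḡ⁻²)^ν`; with `ν ≤ p₀` and the γ-clause at degree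
`p₀ − ν`, `(1+β₀)(Dκ₁ + E) ≤ c·A₀·(log ḡ⁻²)^{p₀−ν}`, the margin `(1+β₀)(κ₁N + E) ≤ c·p₀(ḡ)` follows; the (2.5)-window
form `margin_of_gammaClause` is the instance `D = (1+F)L`, `ν = r`.  The cell located this sentence before (GAPS
G-t4-U4-2: «(1/2)ν ≤ p₀ − p₁ − 1 does not by itself give ν < p₀»; closed for ONE run by the cap «N ≦ R_k» of p. 361 in
`t4/T4-XREAD-U5c.md` Q1/[A1], `R_k` being the (2.5)-window of degree `r < p₀`) — this theorem is the kernel form of that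
arithmetic, here spent on the (η) price `2^N`.  Which printed restriction binds the TWO-RUN window (this one, p. 361, or
another) is the re-read row's question (record `t4/T4-EST-NE7c-P2.md` Q-η-1), consumed here only as the binder `hN`.
[folklore] -/
theorem margin_of_windowPow {gbar β₀ A₀ c D E κ₁ Nw : ℝ} {p₀ ν : ℕ} (hν : ν ≤ p₀) (hβ : 0 ≤ β₀) (hE : 0 ≤ E)
    (hκ : 0 ≤ κ₁) (hx1 : 1 ≤ Real.log (gbar ^ 2)⁻¹) (hN : Nw ≤ D * (Real.log (gbar ^ 2)⁻¹) ^ ν)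
    (hγ : (1 + β₀) * (D * κ₁ + E) ≤ c * A₀ * (Real.log (gbar ^ 2)⁻¹) ^ (p₀ - ν)) :
    (1 + β₀) * (κ₁ * Nw + E) ≤ c * p0Profile A₀ p₀ gbar := by
  set x : ℝ := Real.log (gbar ^ 2)⁻¹ with hx
  have hxν : 1 ≤ x ^ ν := one_le_pow₀ hx1
  have hsum : κ₁ * Nw + E ≤ (D * κ₁ + E) * x ^ ν := by
    have h1 : κ₁ * Nw ≤ κ₁ * (D * x ^ ν) := mul_le_mul_of_nonneg_left hN hκ
    have h2 : E ≤ E * x ^ ν := by nlinarith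
    nlinarith
  have hprof : p0Profile A₀ p₀ gbar = A₀ * x ^ p₀ := rfl
  have hsplit : x ^ p₀ = x ^ (p₀ - ν) * x ^ ν := by rw [← pow_add, Nat.sub_add_cancel hν]
  calc (1 + β₀) * (κ₁ * Nw + E) ≤ (1 + β₀) * ((D * κ₁ + E) * x ^ ν) :=
        mul_le_mul_of_nonneg_left hsum (by linarith)
    _ = ((1 + β₀) * (D * κ₁ + E)) * x ^ ν := by ring
    _ ≤ (c * A₀ * x ^ (p₀ - ν)) * x ^ ν := mul_le_mul_of_nonneg_right hγ (by positivity)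
    _ = c * p0Profile A₀ p₀ gbar := by rw [hprof, hsplit]; ring

/- Sanity instance of the print-shaped form: `ḡ² = e^{−2}` (`log ḡ⁻² = 2`), window `N ≤ 3·2 = 6` (`D = 3`, `ν = 1`),
`p₀ = 5`, `β₀ = 0`, `κ₁ = E = c = A₀ = 1`: the γ-clause reads `1·(3 + 1) = 4 ≤ 2^4`, and the margin returned is
`1·6 + 1 = 7 ≤ 2^5 = 32`. -/
example : (1 + (0 : ℝ)) * (1 * 6 + 1) ≤ 1 * p0Profile 1 5 (Real.exp (-1)) := by
  have hlog : Real.log ((Real.exp (-1)) ^ 2)⁻¹ = 2 := by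
    rw [← Real.exp_nat_mul, ← Real.exp_neg, Real.log_exp]; norm_num
  have h := margin_of_windowPow (gbar := Real.exp (-1)) (β₀ := 0) (A₀ := 1) (c := 1) (D := 3) (E := 1) (κ₁ := 1)
    (Nw := 6) (p₀ := 5) (ν := 1) (by norm_num) le_rfl zero_le_one zero_le_one (by rw [hlog]; norm_num)
    (by rw [hlog]; norm_num) (by rw [hlog]; norm_num)
  simpa using h

end Margin

end

end Literature.MathematicalPhysics.QuantumFieldTheory.Balaban1983to89.T4ShellSuppressionRoute
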